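import Literature.MathematicalPhysics.QuantumFieldTheory.BalabanImbrieJaffe1984to88.BIJ88SmallBlockFields332
import Literature.MathematicalPhysics.QuantumFieldTheory.BalabanImbrieJaffe1984to88.BIJ88SecondTranslation327Torus
import Literature.MathematicalPhysics.QuantumFieldTheory.BalabanImbrieJaffe1984to88.BIJ88Small333GaugeField

/-!
# `BalabanImbrieJaffe1984to88.BIJ88SmallBlockFields332Ubar` — T. Bałaban, J. Imbrie, A. Jaffe, *Effective action and cluster properties of
the abelian Higgs model*, Commun. Math. Phys. **114** (1988) 257–315 [BalabanImbrieJaffe1988], p. 270 **(3.32), third clause, AT PRINT'S `ū₁`**: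
*"In the small field region Λ₀^{(0)} we have small block fields: |v(p) − 1| ≦ ce₀p(e₀), |ψ(y)| ≦ cp(e₀)λ₀^{−1/4}, |(D_{ū₁}ψ)(b′)| ≦ cp(e₀),
b′ ∈ Λ₀^{(0)′*}, (3.32) where ū₁(b′) = ū₁(⟨b′₋, b′₊⟩)."* with the background of the same page *"u₁ = (Λ₁^{(0)*}Q^{s*}v)(Λ₆^{(0)*c}u^{(0)})
exp(ie₀Λ₄^{(0)*}L^{−2}C^{(0)}_{loc}∂*Q^{e*}f). Here u^{(0)} = exp(ie₀A^{(0)})."* (p. 270 = PDF 14, read AS AN IMAGE this session; the sign of the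
last exponential is typed as in (3.28)/(4.2), r18's transcription note T8 — immaterial for the sizes below).

statement-level skeleton of published theorems with citation tags; proofs where landed; nothing here is a claim about the Yang–Mills mass gap

CITATION HEADER (lean-in-tree rule).  Part of the lit-balaban TYPED SKELETON (HOME `run/shared/lean/pub/lit-balaban/`), PHASE-2 proof seat p30
gen 32 (unit `lit-balaban-p30`; TAKING #3 HOME/STATUS.md 2026-08-23T12:57Z).  Row served: **C2.Eq3.32** of `HOME/lit-balaban-r18/ROWS-C2.md`
(owner r18).  File 1 of this seat (`BIJ88SmallBlockFields332`, p363629/p364216/p364557) proved (3.15) ⟹ (3.32) for r18's typed predicates with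
the covariant derivative taken at the block field `v = Qu` itself (its READING (a): the leading factor of `ū₁`).  THIS FILE REMOVES THAT READING:
the third clause is proved with the covariant derivative taken at print's `ū₁`, the straight-line product (4.4) `ū_{k,b} = u_k(⟨b₋, b₊⟩)`
(p. 274; r18's typed `BIJ88Sect4Statements.barU`, their transcription; p34's `toC_barU`) of the p. 270 background `u₁`, in the two typings the tree has for `u₁`:
* (A) GROUP LEVEL, the (4.2)-shape `u₁ = (Q^{s*}v)·w(v)` (p34's `BIJ88RT51Background42.bg42 1 w v`, any correction functional `w`), with
  `ū₁ = barU 1 u₁`; THE CORRECTION OF RECORD is p29's `BIJ88SecondTranslation327Torus.w327` = `exp[−ie₀Λ₄*L^{−2}C^{(0)}_{loc}∂*Q^{e*}f]` composed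
  from p09's `C^{(0)}_{loc}`, p30's `∂*`, p31's `Q^{e*}` — the `Λ₁* ∩ Λ₆*` form of the display, equal there to r18's typed `u1bg` by p29's bridge
  `u1bg_corr327_eq_cfg_bg42` (dictionary `cfg_barU_bg42_w327_eq_prod_u1bg` below);
* (B) r18's ℂ-VALUED `BIJ88Sect3Translations.u1bg` WITH ALL THREE FACTORS (`Q^{s*}v` on `Λ₁*`, `u^{(0)} = e^{ie₀A^{(0)}}` off `Λ₆*`, the
  correction phase on `Λ₄*`), `ū₁(b′) = Π_{s<L} u₁(b_s)` along the straight line of `b′` (the (4.4) product read in `ℂ`, `toC_barU`'s shape),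
  on the bonds `b′` whose lines lie in `Λ₁*`.

THE MECHANISM (one line of print: `ū₁` differs from `v` by unimodular factors close to `1`).  `Π_{s<L}(Q^{s*}v)(b_s) = v(b′)` (p34's
`barU_qsstarGIter0` / `barU_bg42`), so `ū₁(b′) = v(b′)·Π_{s<L}Z(b_s)` with `|Z(b_s) − 1| ≤ δ` (`δ = e₀L^{−2}|corr|`, plus `e₀|A^{(0)}|` off `Λ₆*` by
(3.33)); `|Π Z − 1| ≤ Σ|Z − 1| ≤ Lδ` (§0–§1); `|(D_{ū₁}ψ)(b′)| ≤ |(D_vψ)(b′)| + Lδ|ψ(b′₊)| ≤ 17d²L²p(e₀) + Lδ·17d²L²p(e₀)λ₀^{−1/4} ≤ 2·17d²L²p(e₀)`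
when `Lδ ≤ λ₀^{1/4}` (file 1's `norm_covD_perturb_le` and `smallBlock332_of_smallField315_all`; `smallBlock332_perturb`).

WHAT IS PROVED (0 `sorry`, 0 `def`, 0 `Prop`-valued facts; axioms standard).
* §1 `norm_toC_barU_one_sub_one_le` / `_of_le`: `|ū(Z)(b′) − 1| ≤ Σ_{s<L}|Z(b_s) − 1| ≤ Lδ`.
* §2 `cfg_barU_bg42` (`ū₁(b′) = v(b′)·ū(w(v))(b′)`), `norm_cfg_barU_bg42_sub`, `norm_covD_ubar_le`, **`smallBlock332_perturb`** (the typed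
  (3.32) is stable, with `c ↦ 2c`, under `|ū − V| ≤ Δ ≤ λ₀^{1/4}` in the `D`-slot; any level), **`smallBlock332_ubar_of_smallField315`**
  ((3.15) ⟹ `SmallBlock332 (2·17d²L²) e₀ p(e₀) λ₀ Λ′ v(∂·) ψ (D_{ū₁}ψ)` at `ū₁ = barU 1 (bg42 1 w (Qu))`, any `w` with `|w(v)(b_s) − 1| ≤ δ` on
  the lines of `Λ′*`, `Lδ ≤ λ₀^{1/4}`; every `U(1)` field, no gauge condition).
* §3 (typing (B)) `prod_cfg_qsstarG_line`, `u1bg_of_mem`, `norm_corrFactor`, `norm_corrFactor_sub_one_le` (`|Z(b) − 1| ≤ e₀a + e₀κ` under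
  `|A^{(0)}_b| ≤ a` off `Λ₆*`, `L^{−2}|corr(b)| ≤ κ` on `Λ₄*`), `prod_u1bg_line`, `norm_prod_u1bg_line_sub_le`,
  **`smallBlock332_u1bgBar_of_smallField315`** (the clause at `ū₁(b′) = Π_{s<L} u1bg … (b_s)`, lines of `Λ′*` inside `Λ₁*`, `Le₀(a+κ) ≤ λ₀^{1/4}`).
* §4 (the correction of record) `toC_w327`, `norm_toC_w327_sub_one_le` (`≤ e₀|(D^{(0)}f)(b)|`), `toC_w327_of_not_mem`,
  **`norm_toC_w327_sub_one_le_of_bound`** (`≤ e₀·M·d(2(1+d/δ))^d·4d·c₂·p(e₀)` — p27's `abs_clocCorr_le_of_bound` BY NAME, under the kernel bound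
  `|C^{(0)}_{loc}(b,b′)| ≤ Me^{−δ|b−b′|_∞}` and `|f(q)| ≤ c₂p(e₀)` near `b`), the dictionary **`cfg_barU_bg42_w327_eq_prod_u1bg`**, `abs_f326_le_of_smallF`
  (p31's `SmallF` feeds the `f`-hypothesis), and the assembled **`smallBlock332_u1bar_of_smallField315`** / **`…_of_smallF`** (fed by p31's
  `SmallF` on `Λ₀′**` + the located margin).
* §5 (the untranslated field and the UNIFORM form) `norm_cfg_barU_sub_qU_le` (axial gauge `δ_{Ax}`: `|ū(b′) − v(b′)| ≤ 2N·ε` from the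
  plaquette smallness `|arg u(p)| ≤ ε` on the two blocks of `b′`, `N ≥ N₃`, `Nε < π` — p31's `abs_argB_loopC_le` / `abs_loopAvg_le`: the
  centre-line product `u(Γ_{xx′})` equals `u(loop_x)·e^{−i·loopAvg}·v(b′)`), `cfg_barU_mul`, and
  **`smallBlock332_ubarY_of_smallField315`**: for `u` in the axial gauge and ANY `U(1)` field `Y` with `|Y(b_s) − 1| ≤ δ` on the lines of `Λ′*`,
  regime `2·17d²L²e₀p(e₀) + Lδ ≤ λ₀^{1/4}`: `SmallBlock332 (2·17d²L²) … (D_{ū₁}ψ)` at `ū₁ = barU 1 (u·Y)` — NO RESTRICTION on where the lines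
  lie.  Print's `u₁` is of this form bondwise: `Y = 1` off `Λ₁*` ((3.24)/(3.27): `u₁ = u^{(0)} = u′ = u` there), `Y = (u′)^{−1}·Z` on `Λ₁*`
  (`u = u′·Q^{s*}v`, `u′ = e^{ie₀A′}`, p. 269 *"with |A′_b| ≦ cp(e₀) in Λ₁^{(0)*}"* — p31's `smallAPrime_of_plaquettes`, `c = 6d²L²`).
* §6 (v1.1, gen 34: THE TWO LOCATED ANALYTIC INPUTS OF §4 DISCHARGED BY NAME) `smallF_of_smallField315` ((3.15)'s plaquette clause on `Λ**`
  ⟹ p31's `SmallF (17d²L²) p(e₀) e₀ Λ₀′ v(∂·)` for `v = Qu` in ANY gauge — p31's `smallF_of_plaquettes` at the axial representative of file 1's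
  §6, `qU_gaugeAct_holFix`; margin = p31's four-corner-block clause) and **`smallBlock332_u1bar_byName`**: THERE IS `C > 0` DEPENDING ON
  `(d, L)` ONLY (`C = M′·d(2(1+d/δ′))^d·4d·17d²L²` with p09's `(M′, δ′)` of `BIJ88ClocEstimatesTorus.cloc_decay`) such that on every torus with
  `P.d = d`, `P.L = L`: (3.15) at the objects of record + the located margins + the regimes `17d²L²e₀p < π`, `2·17d²L²e₀p ≤ λ₀^{1/4}`,
  `L·e₀·C·p(e₀) ≤ λ₀^{1/4}` ⟹ `SmallBlock332 (2·17d²L²) e₀ p(e₀) λ₀ Λ′ v(∂·) ψ (D_{ū₁}ψ)` at print's `ū₁ = barU 1 (bg42 1 w₃₂₇ v)` — the kernel bound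
  on `C^{(0)}_{loc}` and the bound `|f| ≤ c₂p(e₀)` are NO LONGER hypotheses (p09's `cloc_decay`, p31's `smallF_of_plaquettes` inside); every radius
  `R`, every `Λ₄*`.
* §7 (v1.1, gen 34: THE SAME FOR TYPING (B)) `corr327_cfg_eq_mulVec` (p29's correction of record = p27's matrix–vector composite at the field
  strengths of `v`) and **`smallBlock332_u1bgBar_byName`**: THERE IS `C > 0` ON `(d, L)` ONLY (`C = 6d²L² + 2·M′d(2(1+d/δ′))^d·4d·17d²L²`) such
  that, for `u` in the axial gauge `δ_{Ax}` of (3.11), (3.15) at the objects of record + the located margins (+ the lines of `Λ′*` inside `Λ₁*`) +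
  the three regimes ⟹ `SmallBlock332 (2·17d²L²) … (D_{ū₁}ψ)` at `ū₁(b′) = Π_{s<L} u1bg Λ₁* Λ₄* Λ₆* (Q^{s*}v) e₀ L A^{(0)} corr₃₂₇ (b_s)` for EVERY
  `A^{(0)}` tied to print's `A′ = arg(u′)/e₀` by (3.27) (p27's `h327` shape) — the inputs `|A^{(0)}_b| ≤ a` ((3.33): p27's
  `small333_gauge_of_plaquettes`) and `L^{−2}|corr(b)| ≤ κ` (p27's `abs_clocCorr_le_of_bound`) of §3 DISCHARGED BY NAME over p09's `cloc_decay`.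

READINGS (ours, disclosed).  (a) `ū₁(⟨b′₋, b′₊⟩)` = the product of `u₁` over the `L` bonds of the straight line from the centre of `B(b′₋)` to
the centre of `B(b′₊)` — the tree embeds `T^{(1)} ⊂ T^{(0)}` by block centres (`B15DeterminingSets.embIter`, r18's `barU`); (b) `v = Qu` ((2.10),
the δ-function renormalization transformation of [2]), as in file 1; (c) the coarse prefactor `c′ ∈ [0,1]` of `D` as in file 1; (d) explicit
constants: `c = 2·17d²L²` and the smallness HYPOTHESES `Lδ ≤ λ₀^{1/4}` (print's *"c"* absorbs `e₀`-smallness against `λ₀^{−1/4}`; here it is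
kept as a located inequality, like file 1's `2·17d²L²e₀p(e₀) ≤ λ₀^{1/4}`); (e) located margins as hypotheses: the lines of the bonds of `Λ′*` lie
in `Λ₁*` (typing (B)) and the field strengths of `v` are small on the coarse plaquettes based near those lines (§4, p27's shape) — print's
regions `Λ₀′ ⊂ Λ₀`, `Λ₁ = Λ₀` minus `r(e₀)`-cubes.
HONEST SCOPE.  (i) Typings (A)/(B) cover the bonds `b′` whose lines lie in `Λ₁*` (resp. `Λ₁* ∩ Λ₆*` for the instance of record); §5's
uniform form covers every `b′ ∈ Λ′*` but takes the bondwise factor `Y = u₁/u` ABSTRACTLY (`|Y − 1| ≤ δ`) and `u` in the axial gauge of (3.11)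
— the identification `Y = (u′)^{−1}Z` on `Λ₁*` / `Y = 1` off `Λ₁*` is displayed above, not typed as a theorem about `u1bg`; (ii) (3.33) `|A^{(0)}| ≤ cp(e₀)` enters typing (B) as the hypothesis `|A^{(0)}_b| ≤ a` (p27's `small333_gauge` proves it
from the restrictions on the plaquette variables); the kernel bound on `C^{(0)}_{loc}` is a hypothesis as in p27's file (p09's (7.2.3)
`cloc_decay` provides `M, δ` uniformly in the torus) — v1.1 §6 DISCHARGES it, and the `|f| ≤ c₂p(e₀)` input, BY NAME for typing (A), and §7
does the same for typing (B) (there also `|A^{(0)}| ≤ a` := p27's (3.33) gauge half; `u` in the axial gauge `δ_{Ax}`, as (3.11) integrates, and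
`A^{(0)}` any function tied to `arg(u′)/e₀` by (3.27) — p27's `h327`); what stays located in §6–§7 is GEOMETRY ONLY: file 1's margins `hΛ₁`/`hΛ₂` (the fine sites / plaquettes of the blocks of `Λ′` lie in `Λ` / `Λ**`), the
four-corner-block clause for `Λ₀′` (p31's shape) and the `R + 4L + 1` line collar of §4 (print: `Λ₀′ ⊂ Λ₀`, `Λ₁ = Λ₀` minus `r(e₀)`-cubes,
`R = ¼r(e₀)`; the first-step regions themselves are r18's/r16's data, not constructed here), plus the three `e₀`-smallness regimes with ONE
existential constant `C(d, L)` (print's *"c"* and *"e₀ sufficiently small"*); (iii) levels `(0, 1)` = the first step (p29's bridge and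
`barU`/`bg42` are based at `T^{(0)}`); (iv) constants not optimized.  Imports Literature only; re-declares nothing; NOT summit progress; NOT
continuum; NOT Clay.
Unit `lit-balaban-p30` gen 32 (literature-prover-lit-balaban-p30-g32-0), 2026-08-23; v1.1 (§6–§7, append-only; §§0–5 unchanged) gen 34
(literature-prover-lit-balaban-p30-g34-0), 2026-08-23, TAKING HOME/STATUS.md 2026-08-23T15:48:04Z.
-/

namespace Literature.MathematicalPhysics.QuantumFieldTheory.BalabanImbrieJaffe1984to88.BIJ88SmallBlockFields332Ubar

open Literature.MathematicalPhysics.QuantumFieldTheory.Balaban1983to89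
open BIJ88Sect3Statements (U1 toC toC_mul toC_one norm_toC cfg covD plaqVar plaqVar_cfg fieldStrength starB starP mem_starB
  SmallField315 SmallBlock332)
open BIJ85Sect1Model (HiggsField)
open BIJ85BlockAveragesTorus (qU qCov expU1 toC_expU1 runC runC_ne_zero corner loopC loopAvg holC_of_deltaAx toC_qU offs blockSite_offs)
open BIJ88Sect4Statements (barU)
open BIJ88Eq44OneStroke (toC_barU)
open BIJ88RT51Background (barU_qsstarGIter0)
open BIJ88RT51Background42 (bg42 bg42_apply barU_bg42 barU_mul)
open BIJ85Eq453GaugeField (qsstarG qsstarGIter0)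
open BIJ88Sect3Translations (u1bg phase)
open BIJ88SecondTranslation327Torus (f326 corrOp corr327 corr327_eq_mulVec D327 D327_fieldStrength w327 norm_phase
  qsstarGIter0_one u1bg_corr327_eq_cfg_bg42)
open BIJ88Small333GaugeField (abs_clocCorr_le_of_bound)
open BIJ88ClocEstimatesTorus (Cloc)
open BIJ88ClocFactorsTorus (distB)
open BIJ85CurlQsstar (torusEdgeCells)
open BIJ85Eq531Proof (plaqDiv)
open LatticeFieldCalculus (supDist)
open B15DeterminingSets (embIter)
open BIJ88Sect5StatementsPart3 (SmallF)
open BIJ88SmallBlockFields332 (norm_covD_perturb_le smallBlock332_of_smallField315_all smallBlock332_of_smallField315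
  plaqSmall_of_smallField315)
open BIJ88Eq531SmallAPrime (abs_argB_loopC_le abs_loopAvg_le exp_argB_mul_I_of_norm)
open BIJ88Eq531SmallF (const_le_seventeen)
open BIJ88RenormTransf311 (DeltaAx)
open BIJ85Sect1Model (argB)
open GaugeField (plaqHol)
open scoped BigOperators Real Matrix
open Complex Finset

noncomputable section

variable {P : Params}

/-! ## §0  Scalar kernels -/

/-- kernel: `‖e^{iθ} − 1‖ ≤ |θ|` (chord ≤ arc). [folklore] -/
private theorem norm_cexp_mul_I_sub_one_le (θ : ℝ) : ‖Complex.exp ((θ : ℂ) * I) - 1‖ ≤ |θ| := by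
  have h := Real.norm_exp_I_mul_ofReal_sub_one_le (x := θ)
  rw [mul_comm] at h
  simpa [Real.norm_eq_abs] using h

/-- kernel: **a product of unit complex numbers is within the sum of the individual deviations of `1`**:
`‖Π_{t<n} z_t − 1‖ ≤ Σ_{t<n} ‖z_t − 1‖` for `|z_t| = 1` (telescoping). [folklore] -/
private theorem norm_prod_range_sub_one_le (z : ℕ → ℂ) (hz : ∀ t, ‖z t‖ = 1) (n : ℕ) :
    ‖(∏ t ∈ range n, z t) - 1‖ ≤ ∑ t ∈ range n, ‖z t - 1‖ := by
  induction n with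
  | zero => simp
  | succ n ih =>
    rw [prod_range_succ, sum_range_succ]
    have hn : ‖∏ t ∈ range n, z t‖ = 1 := by
      rw [norm_prod]
      exact prod_eq_one fun t _ => hz t
    calc ‖(∏ t ∈ range n, z t) * z n - 1‖ = ‖(∏ t ∈ range n, z t) * (z n - 1) + ((∏ t ∈ range n, z t) - 1)‖ := by ring_nf
      _ ≤ ‖(∏ t ∈ range n, z t) * (z n - 1)‖ + ‖(∏ t ∈ range n, z t) - 1‖ := norm_add_le _ _
      _ = ‖z n - 1‖ + ‖(∏ t ∈ range n, z t) - 1‖ := by rw [norm_mul, hn, one_mul]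
      _ ≤ (∑ t ∈ range n, ‖z t - 1‖) + ‖z n - 1‖ := by linarith

/-! ## §1  `ū` of a near-unit field: `‖ū(Z)(b′) − 1‖ ≤ Σ_{s<L} ‖Z(b_s) − 1‖` -/

/-- **The straight-line product (4.4) of a `U(1)` field close to `1` is close to `1`**: for the bond `b′` of `T^{(1)}` and its `L` line bonds
`b_s = ⟨b′₋ + se_μ, μ⟩` (centres embedded by `embIter 1`, r18's `barU`/`toC_barU`), `‖ū(Z)(b′) − 1‖ ≤ Σ_{s<L} ‖Z(b_s) − 1‖` (standing range).
[cite: BalabanImbrieJaffe1988, (4.4) p.274] -/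
theorem norm_toC_barU_one_sub_one_le (h1 : 1 ≤ P.m + P.K) (Z : GaugeField P 0 U1) (c : PBond P 1) :
    ‖toC (barU 1 Z c) - 1‖ ≤
      ∑ s ∈ range P.L, ‖toC (Z ⟨LatticeFieldCalculus.runSite (embIter 1 c.src) c.dir s, c.dir⟩) - 1‖ := by
  rw [toC_barU h1 Z c, pow_one]
  exact norm_prod_range_sub_one_le _ (fun s => norm_toC _) P.L

/-- … hence `‖ū(Z)(b′) − 1‖ ≤ L·δ` when `‖Z(b_s) − 1‖ ≤ δ` on the `L` line bonds of `b′`. [cite: BalabanImbrieJaffe1988, (4.4) p.274] -/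
theorem norm_toC_barU_one_sub_one_le_of_le (h1 : 1 ≤ P.m + P.K) (Z : GaugeField P 0 U1) (c : PBond P 1) {δ : ℝ}
    (hZ : ∀ s < P.L, ‖toC (Z ⟨LatticeFieldCalculus.runSite (embIter 1 c.src) c.dir s, c.dir⟩) - 1‖ ≤ δ) :
    ‖toC (barU 1 Z c) - 1‖ ≤ P.L * δ := by
  refine (norm_toC_barU_one_sub_one_le h1 Z c).trans ?_
  calc ∑ s ∈ range P.L, ‖toC (Z ⟨LatticeFieldCalculus.runSite (embIter 1 c.src) c.dir s, c.dir⟩) - 1‖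
      ≤ ∑ _s ∈ range P.L, δ := sum_le_sum fun s hs => hZ s (mem_range.1 hs)
    _ = P.L * δ := by rw [sum_const, card_range, nsmul_eq_mul]

/-! ## §2  Print's `ū₁` for a (4.2)-shaped background `u₁ = (Q^{s*}v)·w(v)`: the third clause of (3.32), generic correction -/

/-- **`ū₁(b′) = v(b′)·ū(w(v))(b′)`** read in `ℂ`: for the background `u₁ = (Q^{s*}v)·w(v)` (p34's group-level (4.2)-shape `bg42 1 w v`),
the straight-line product (4.4) is the block field itself times `ū` of the correction factor (p34's `barU_bg42`: `ū(Q^{s*}v) = v`).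
[cite: BalabanImbrieJaffe1988, (4.4) p.274] -/
theorem cfg_barU_bg42 (h1 : 1 ≤ P.m + P.K) (w : GaugeField P 1 U1 → GaugeField P 0 U1) (V : GaugeField P 1 U1) (c : PBond P 1) :
    cfg (barU 1 (bg42 1 w V)) c = cfg V c * toC (barU 1 (w V) c) := by
  show toC (barU 1 (bg42 1 w V) c) = toC (V c) * toC (barU 1 (w V) c)
  rw [barU_bg42 h1 w V]
  exact toC_mul _ _

/-- **`|ū₁(b′) − v(b′)| = |ū(w(v))(b′) − 1|`** (`|v(b′)| = 1`). [cite: BalabanImbrieJaffe1988, (3.32) p.270] -/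
theorem norm_cfg_barU_bg42_sub (h1 : 1 ≤ P.m + P.K) (w : GaugeField P 1 U1 → GaugeField P 0 U1) (V : GaugeField P 1 U1) (c : PBond P 1) :
    ‖cfg (barU 1 (bg42 1 w V)) c - cfg V c‖ = ‖toC (barU 1 (w V) c) - 1‖ := by
  rw [cfg_barU_bg42 h1, ← mul_sub_one, norm_mul, show ‖cfg V c‖ = 1 from norm_toC _, one_mul]

/-- **The covariant derivative at print's `ū₁` versus at `v`**: `‖(D_{ū₁}ψ)(b′)‖ ≤ ‖(D_vψ)(b′)‖ + |c′|·‖ū(w(v))(b′) − 1‖·‖ψ(b′₊)‖`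
(file 1's `norm_covD_perturb_le` at `ū₁ = v·ū(w(v))`). [cite: BalabanImbrieJaffe1988, (3.32) p.270] -/
theorem norm_covD_ubar_le (h1 : 1 ≤ P.m + P.K) (w : GaugeField P 1 U1 → GaugeField P 0 U1) (V : GaugeField P 1 U1)
    (ψ : Balaban1983to89.Site P 1 → ℂ) (c' : ℝ) (c : PBond P 1) :
    ‖covD c' (cfg (barU 1 (bg42 1 w V))) ψ c‖ ≤ ‖covD c' (cfg V) ψ c‖ + |c'| * ‖toC (barU 1 (w V) c) - 1‖ * ‖ψ c.tgt‖ := by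
  have h := norm_covD_perturb_le c' (cfg (barU 1 (bg42 1 w V))) (cfg V) ψ c
  rwa [norm_cfg_barU_bg42_sub h1] at h

/-- **THE TYPED PREDICATE (3.32) UNDER A PERTURBATION OF THE COARSE GAUGE FIELD IN `D`**: if `SmallBlock332 c …` holds with the
covariant derivative taken at a bond field `V` and `ū` is any bond field with `|ū(b′) − V(b′)| ≤ Δ ≤ λ₀^{1/4}` on `Λ′*` (`0 ≤ c′ ≤ 1`), then
`SmallBlock332 (2c) …` holds with the covariant derivative taken at `ū` — the extra term `|c′|·Δ·|ψ(b′₊)| ≤ λ₀^{1/4}·c·p(e₀)λ₀^{−1/4}`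
(file 1's `norm_covD_perturb_le`; any level). [cite: BalabanImbrieJaffe1988, (3.32) p.270] -/
theorem smallBlock332_perturb {j : ℕ} {C e₀ pe₀ lam₀ : ℝ} (hC : 0 ≤ C) (he : 0 ≤ e₀) (hpe : 0 ≤ pe₀) (hlam : 0 < lam₀)
    {Λ' : Finset (Balaban1983to89.Site P (j + 1))} {vq : Balaban1983to89.Plaq P (j + 1) → ℂ} {ψ : Balaban1983to89.Site P (j + 1) → ℂ}
    {V : PBond P (j + 1) → ℂ} {c' : ℝ} (hc0 : 0 ≤ c') (hc1 : c' ≤ 1)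
    (k : SmallBlock332 C e₀ pe₀ lam₀ Λ' vq ψ (covD c' V ψ)) (ubar : PBond P (j + 1) → ℂ) {Δ : ℝ} (hΔ0 : 0 ≤ Δ)
    (hnear : ∀ b' ∈ starB Λ', ‖ubar b' - V b'‖ ≤ Δ) (hΔ : Δ ≤ lam₀ ^ (1 / 4 : ℝ)) :
    SmallBlock332 (2 * C) e₀ pe₀ lam₀ Λ' vq ψ (covD c' ubar ψ) := by
  obtain ⟨k1, k2, k3⟩ := k
  have hpow : 0 < lam₀ ^ (-(1 / 4 : ℝ)) := Real.rpow_pos_of_pos hlam _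
  have hpow' : lam₀ ^ (1 / 4 : ℝ) * lam₀ ^ (-(1 / 4 : ℝ)) = 1 := by
    rw [← Real.rpow_add hlam]; norm_num
  have hCe : 0 ≤ C * e₀ * pe₀ := mul_nonneg (mul_nonneg hC he) hpe
  have hCp : 0 ≤ C * pe₀ * lam₀ ^ (-(1 / 4 : ℝ)) := mul_nonneg (mul_nonneg hC hpe) hpow.le
  refine ⟨fun q hq => ?_, fun y hy => ?_, fun b' hb' => ?_⟩
  · calc ‖vq q - 1‖ ≤ C * e₀ * pe₀ := k1 q hq
      _ ≤ 2 * C * e₀ * pe₀ := by nlinarith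
  · calc ‖ψ y‖ ≤ C * pe₀ * lam₀ ^ (-(1 / 4 : ℝ)) := k2 y hy
      _ ≤ 2 * C * pe₀ * lam₀ ^ (-(1 / 4 : ℝ)) := by nlinarith
  · have htgt : b'.tgt ∈ Λ' := ((mem_starB Λ' b').1 hb').2
    have hψ : ‖ψ b'.tgt‖ ≤ C * pe₀ * lam₀ ^ (-(1 / 4 : ℝ)) := k2 _ htgt
    have habs : |c'| ≤ 1 := by rw [abs_of_nonneg hc0]; exact hc1
    have hA : |c'| * ‖ubar b' - V b'‖ * ‖ψ b'.tgt‖ ≤ 1 * Δ * (C * pe₀ * lam₀ ^ (-(1 / 4 : ℝ))) :=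
      mul_le_mul (mul_le_mul habs (hnear b' hb') (norm_nonneg _) zero_le_one) hψ (norm_nonneg _) (mul_nonneg zero_le_one hΔ0)
    calc ‖covD c' ubar ψ b'‖ ≤ ‖covD c' V ψ b'‖ + |c'| * ‖ubar b' - V b'‖ * ‖ψ b'.tgt‖ := norm_covD_perturb_le c' ubar V ψ b'
      _ ≤ C * pe₀ + 1 * Δ * (C * pe₀ * lam₀ ^ (-(1 / 4 : ℝ))) := add_le_add (k3 b' hb') hA
      _ ≤ C * pe₀ + lam₀ ^ (1 / 4 : ℝ) * (C * pe₀ * lam₀ ^ (-(1 / 4 : ℝ))) := by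
          rw [one_mul]; exact add_le_add le_rfl (mul_le_mul_of_nonneg_right hΔ hCp)
      _ = C * pe₀ + C * pe₀ * (lam₀ ^ (1 / 4 : ℝ) * lam₀ ^ (-(1 / 4 : ℝ))) := by ring
      _ = 2 * C * pe₀ := by rw [hpow']; ring

/-- **(3.15) ⟹ (3.32) WITH PRINT'S `ū₁`, GENERIC CORRECTION** (p. 270: *"|(D_{ū₁}ψ)(b′)| ≦ cp(e₀), b′ ∈ Λ₀^{(0)′*}, (3.32) where
ū₁(b′) = ū₁(⟨b′₋, b′₊⟩)"*): for the unit-lattice `U(1)` field `u` (ANY gauge), its block field `v = Qu` ((2.10)) and a background of the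
(4.2)/p. 270 shape `u₁ = (Q^{s*}v)·w(v)` whose correction factor satisfies `|w(v)(b_s) − 1| ≤ δ` on the `L` line bonds of every `b′ ∈ Λ′*`,
with `L·δ ≤ λ₀^{1/4}`: if `(u, φ, ψ)` satisfy (3.15) on `(Λ, Λ′)` at the objects of record (file 1's hypotheses verbatim: margins `hΛ₁`/`hΛ₂`,
`17d²L²e₀p(e₀) < π`, `2·17d²L²e₀p(e₀) ≤ λ₀^{1/4}`, `0 < λ₀ ≤ 1`, `0 ≤ c′ ≤ 1`), then r18's `SmallBlock332` holds on `Λ′` with the constant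
**`c = 2·17d²L²`** for `v`, `ψ` and the covariant derivative `D_{ū₁}ψ` AT PRINT'S `ū₁ = barU 1 u₁` — `|ū₁(b′) − v(b′)| ≤ Lδ` (§1) costs
`Lδ·|ψ(b′₊)| ≤ λ₀^{1/4}·17d²L²p(e₀)λ₀^{−1/4}`. [cite: BalabanImbrieJaffe1988, (3.32) p.270] -/
theorem smallBlock332_ubar_of_smallField315 (h1 : 1 ≤ P.m + P.K) (U : GaugeField P 0 U1)
    {e₀ pe₀ lam₀ : ℝ} (he : 0 < e₀) (hpe : 0 ≤ pe₀) (hlam : 0 < lam₀) (hlam1 : lam₀ ≤ 1)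
    (hπ : 17 * (P.d : ℝ) ^ 2 * (P.L : ℝ) ^ 2 * (e₀ * pe₀) < π)
    (hsm : 2 * (17 * (P.d : ℝ) ^ 2 * (P.L : ℝ) ^ 2) * (e₀ * pe₀) ≤ lam₀ ^ (1 / 4 : ℝ))
    {Λ : Finset (Balaban1983to89.Site P 0)} {Λ' : Finset (Balaban1983to89.Site P 1)}
    (hΛ₁ : ∀ x : Balaban1983to89.Site P 0, blockOf x ∈ Λ' → x ∈ Λ)
    (hΛ₂ : ∀ p : Balaban1983to89.Plaq P 0, blockOf p.src ∈ Λ' → p ∈ starP Λ)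
    {ψ : Balaban1983to89.Site P 1 → ℂ} {φ : HiggsField P 0} {c' : ℝ} (hc0 : 0 ≤ c') (hc1 : c' ≤ 1)
    (h : SmallField315 pe₀ lam₀ Λ Λ' (covD 1 (cfg U) φ) ψ (qCov U φ) φ (fun p => ‖fieldStrength e₀ (plaqVar (cfg U) p)‖))
    (w : GaugeField P 1 U1 → GaugeField P 0 U1) {δ : ℝ} (hδ0 : 0 ≤ δ)
    (hw : ∀ b' ∈ starB Λ', ∀ s < P.L,
      ‖toC (w (qU U) ⟨LatticeFieldCalculus.runSite (embIter 1 b'.src) b'.dir s, b'.dir⟩) - 1‖ ≤ δ)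
    (hδ : (P.L : ℝ) * δ ≤ lam₀ ^ (1 / 4 : ℝ)) :
    SmallBlock332 (2 * (17 * (P.d : ℝ) ^ 2 * (P.L : ℝ) ^ 2)) e₀ pe₀ lam₀ Λ' (plaqVar (cfg (qU U))) ψ
      (covD c' (cfg (barU 1 (bg42 1 w (qU U)))) ψ) :=
  smallBlock332_perturb (by positivity) he.le hpe hlam hc0 hc1
    (smallBlock332_of_smallField315_all h1 U he hpe hlam hlam1 hπ hsm hΛ₁ hΛ₂ hc0 hc1 h) _
    (mul_nonneg (Nat.cast_nonneg _) hδ0)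
    (fun b' hb' => by
      rw [norm_cfg_barU_bg42_sub h1]
      exact norm_toC_barU_one_sub_one_le_of_le h1 _ b' (hw b' hb'))
    hδ

/-! ## §3  Print's `u₁` IN r18's TYPING (`BIJ88Sect3Translations.u1bg`, ℂ-valued) on `Λ₁*`: `ū₁(b′) = Π_{s<L} u₁(b_s)` -/

/-- **`Π_{s<L}(Q^{s*}v)(b_s) = v(b′)`** along the straight line of `b′` (read in `ℂ`): the (4.4)-product of the pull-back `Q^{s*}v` is `v`
(p34's `barU_qsstarGIter0` at `k = 1` + `toC_barU`; p29's `qsstarGIter0_one`; standing range). [cite: BalabanImbrieJaffe1985, (2.19) p.305] -/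
theorem prod_cfg_qsstarG_line (h1 : 1 ≤ P.m + P.K) (V : GaugeField P 1 U1) (c : PBond P 1) :
    ∏ s ∈ range P.L, cfg (qsstarG V) ⟨LatticeFieldCalculus.runSite (embIter 1 c.src) c.dir s, c.dir⟩ = cfg V c := by
  have h := toC_barU h1 (qsstarGIter0 1 V) c
  rw [barU_qsstarGIter0 h1, pow_one, qsstarGIter0_one] at h
  exact h.symm

/-- **r18's `u₁` factorizes on `Λ₁*`** as `(Q^{s*}v)_b` times the CORRECTION FACTOR
`Z(b) = (Λ₆*ᶜ e^{ie₀A^{(0)}_b})·exp(−ie₀Λ₄*L^{−2}corr(b))` (the last two factors of `u1bg`). [cite: BalabanImbrieJaffe1988, (3.28) p.270] -/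
theorem u1bg_of_mem {Λ₁s Λ₄s Λ₆s : Finset (PBond P 0)} (w : PBond P 0 → ℂ) (e₀ L : ℝ) (A0 corr : PBond P 0 → ℝ) {b : PBond P 0}
    (hb : b ∈ Λ₁s) :
    u1bg Λ₁s Λ₄s Λ₆s w e₀ L A0 corr b =
      w b * ((if b ∈ Λ₆s then (1 : ℂ) else phase e₀ A0 b) *
        Complex.exp (-(I * ((e₀ * (if b ∈ Λ₄s then L ^ (-(2 : ℤ)) * corr b else 0) : ℝ) : ℂ)))) := by
  rw [u1bg, if_pos hb, mul_assoc]

/-- kernel: the correction factor `Z(b)` is unimodular. [cite: BalabanImbrieJaffe1988, (3.28) p.270] -/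
theorem norm_corrFactor {Λ₄s Λ₆s : Finset (PBond P 0)} (e₀ L : ℝ) (A0 corr : PBond P 0 → ℝ) (b : PBond P 0) :
    ‖(if b ∈ Λ₆s then (1 : ℂ) else phase e₀ A0 b) *
        Complex.exp (-(I * ((e₀ * (if b ∈ Λ₄s then L ^ (-(2 : ℤ)) * corr b else 0) : ℝ) : ℂ)))‖ = 1 := by
  rw [norm_mul, Complex.norm_exp]
  have h1 : ‖(if b ∈ Λ₆s then (1 : ℂ) else phase e₀ A0 b)‖ = 1 := by
    split_ifs
    · exact norm_one
    · exact norm_phase e₀ A0 b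
  rw [h1, one_mul]
  simp

/-- **THE SIZE OF THE CORRECTION FACTOR**: `|Z(b) − 1| ≤ e₀·a + e₀·κ` whenever `|A^{(0)}_b| ≤ a` if `b ∉ Λ₆*` ((3.33): *"|A^{(0)}| ≦ cp(e₀) in
Λ₁^{(0)*}"*) and `L^{−2}|corr(b)| ≤ κ` if `b ∈ Λ₄*` (the (3.27) correction is small, p27's file), `e₀, a, κ ≥ 0` (chord ≤ arc twice).
[cite: BalabanImbrieJaffe1988, (3.33) p.270] -/
theorem norm_corrFactor_sub_one_le {Λ₄s Λ₆s : Finset (PBond P 0)} {e₀ L a κ : ℝ} (he : 0 ≤ e₀) (ha : 0 ≤ a) (hκ : 0 ≤ κ)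
    (A0 corr : PBond P 0 → ℝ) (b : PBond P 0) (hA : b ∉ Λ₆s → |A0 b| ≤ a) (hK : b ∈ Λ₄s → L ^ (-(2 : ℤ)) * |corr b| ≤ κ) :
    ‖(if b ∈ Λ₆s then (1 : ℂ) else phase e₀ A0 b) *
        Complex.exp (-(I * ((e₀ * (if b ∈ Λ₄s then L ^ (-(2 : ℤ)) * corr b else 0) : ℝ) : ℂ))) - 1‖ ≤ e₀ * a + e₀ * κ := by
  set z₁ : ℂ := if b ∈ Λ₆s then (1 : ℂ) else phase e₀ A0 b with hz₁
  set r : ℝ := e₀ * (if b ∈ Λ₄s then L ^ (-(2 : ℤ)) * corr b else 0) with hr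
  have e : -(I * (r : ℂ)) = ((-r : ℝ) : ℂ) * I := by push_cast; ring
  have hz₂ : ‖Complex.exp (-(I * (r : ℂ))) - 1‖ ≤ e₀ * κ := by
    rw [e]
    refine (norm_cexp_mul_I_sub_one_le _).trans ?_
    rw [abs_neg, hr]
    split_ifs with h4
    · rw [abs_mul, abs_of_nonneg he, abs_mul]
      refine mul_le_mul_of_nonneg_left ?_ he
      by_cases hL : 0 ≤ L ^ (-(2 : ℤ))
      · rw [abs_of_nonneg hL]; exact hK h4
      · -- `L^{−2} = (L²)⁻¹ ≥ 0` always; this branch is vacuous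
        exfalso; exact hL (by rw [zpow_neg]; exact inv_nonneg.2 (by simpa using zpow_two_nonneg L))
    · rw [mul_zero, abs_zero]; exact mul_nonneg he hκ
  have hz₁le : ‖z₁ - 1‖ ≤ e₀ * a := by
    rw [hz₁]
    split_ifs with h6
    · rw [sub_self, norm_zero]; exact mul_nonneg he ha
    · rw [phase]
      refine (Real.norm_exp_I_mul_ofReal_sub_one_le).trans ?_
      rw [Real.norm_eq_abs, abs_mul, abs_of_nonneg he]
      exact mul_le_mul_of_nonneg_left (hA h6) he
  have hn₁ : ‖z₁‖ = 1 := by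
    rw [hz₁]; split_ifs
    · exact norm_one
    · exact norm_phase e₀ A0 b
  calc ‖z₁ * Complex.exp (-(I * (r : ℂ))) - 1‖ = ‖z₁ * (Complex.exp (-(I * (r : ℂ))) - 1) + (z₁ - 1)‖ := by ring_nf
    _ ≤ ‖z₁ * (Complex.exp (-(I * (r : ℂ))) - 1)‖ + ‖z₁ - 1‖ := norm_add_le _ _
    _ = ‖Complex.exp (-(I * (r : ℂ))) - 1‖ + ‖z₁ - 1‖ := by rw [norm_mul, hn₁, one_mul]
    _ ≤ e₀ * κ + e₀ * a := add_le_add hz₂ hz₁le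
    _ = e₀ * a + e₀ * κ := add_comm _ _

/-- **PRINT'S `ū₁(b′) = ū₁(⟨b′₋, b′₊⟩)` FROM r18's `u₁`, on the lines inside `Λ₁*`**: `Π_{s<L} u₁(b_s) = v(b′)·Π_{s<L} Z(b_s)` — the
pull-back factors multiply to `v(b′)` (`prod_cfg_qsstarG_line`). [cite: BalabanImbrieJaffe1988, (3.32) p.270] -/
theorem prod_u1bg_line (h1 : 1 ≤ P.m + P.K) {Λ₁s Λ₄s Λ₆s : Finset (PBond P 0)} (e₀ L : ℝ) (A0 corr : PBond P 0 → ℝ)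
    (V : GaugeField P 1 U1) {c : PBond P 1}
    (hc : ∀ s < P.L, (⟨LatticeFieldCalculus.runSite (embIter 1 c.src) c.dir s, c.dir⟩ : PBond P 0) ∈ Λ₁s) :
    ∏ s ∈ range P.L, u1bg Λ₁s Λ₄s Λ₆s (cfg (qsstarG V)) e₀ L A0 corr ⟨LatticeFieldCalculus.runSite (embIter 1 c.src) c.dir s, c.dir⟩ =
      cfg V c * ∏ s ∈ range P.L,
        ((if (⟨LatticeFieldCalculus.runSite (embIter 1 c.src) c.dir s, c.dir⟩ : PBond P 0) ∈ Λ₆s then (1 : ℂ)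
            else phase e₀ A0 ⟨LatticeFieldCalculus.runSite (embIter 1 c.src) c.dir s, c.dir⟩) *
          Complex.exp (-(I * ((e₀ * (if (⟨LatticeFieldCalculus.runSite (embIter 1 c.src) c.dir s, c.dir⟩ : PBond P 0) ∈ Λ₄s then
            L ^ (-(2 : ℤ)) * corr ⟨LatticeFieldCalculus.runSite (embIter 1 c.src) c.dir s, c.dir⟩ else 0) : ℝ) : ℂ)))) := by
  rw [← prod_cfg_qsstarG_line h1 V c, ← prod_mul_distrib]
  exact prod_congr rfl fun s hs => u1bg_of_mem _ _ _ _ _ (hc s (mem_range.1 hs))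

/-- **`|ū₁(b′) − v(b′)| ≤ L·(e₀a + e₀κ)`** for r18's `u₁` on a line inside `Λ₁*`, under the (3.33)-bound `|A^{(0)}| ≤ a` on its bonds outside
`Λ₆*` and `L^{−2}|corr| ≤ κ` on its bonds inside `Λ₄*`. [cite: BalabanImbrieJaffe1988, (3.32) p.270] -/
theorem norm_prod_u1bg_line_sub_le (h1 : 1 ≤ P.m + P.K) {Λ₁s Λ₄s Λ₆s : Finset (PBond P 0)} {e₀ L a κ : ℝ} (he : 0 ≤ e₀) (ha : 0 ≤ a)
    (hκ : 0 ≤ κ) (A0 corr : PBond P 0 → ℝ) (V : GaugeField P 1 U1) {c : PBond P 1}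
    (hc : ∀ s < P.L, (⟨LatticeFieldCalculus.runSite (embIter 1 c.src) c.dir s, c.dir⟩ : PBond P 0) ∈ Λ₁s)
    (hA : ∀ s < P.L, (⟨LatticeFieldCalculus.runSite (embIter 1 c.src) c.dir s, c.dir⟩ : PBond P 0) ∉ Λ₆s →
      |A0 ⟨LatticeFieldCalculus.runSite (embIter 1 c.src) c.dir s, c.dir⟩| ≤ a)
    (hK : ∀ s < P.L, (⟨LatticeFieldCalculus.runSite (embIter 1 c.src) c.dir s, c.dir⟩ : PBond P 0) ∈ Λ₄s →
      L ^ (-(2 : ℤ)) * |corr ⟨LatticeFieldCalculus.runSite (embIter 1 c.src) c.dir s, c.dir⟩| ≤ κ) :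
    ‖(∏ s ∈ range P.L, u1bg Λ₁s Λ₄s Λ₆s (cfg (qsstarG V)) e₀ L A0 corr ⟨LatticeFieldCalculus.runSite (embIter 1 c.src) c.dir s, c.dir⟩) -
        cfg V c‖ ≤ P.L * (e₀ * a + e₀ * κ) := by
  rw [prod_u1bg_line h1 e₀ L A0 corr V hc, ← mul_sub_one, norm_mul, show ‖cfg V c‖ = 1 from norm_toC _, one_mul]
  refine (norm_prod_range_sub_one_le _ (fun s => norm_corrFactor e₀ L A0 corr _) P.L).trans ?_
  calc _ ≤ ∑ _s ∈ range P.L, (e₀ * a + e₀ * κ) := sum_le_sum fun s hs =>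
          norm_corrFactor_sub_one_le he ha hκ A0 corr _ (hA s (mem_range.1 hs)) (hK s (mem_range.1 hs))
    _ = P.L * (e₀ * a + e₀ * κ) := by rw [sum_const, card_range, nsmul_eq_mul]

/-- **(3.15) ⟹ (3.32) WITH PRINT'S `ū₁` COMPUTED FROM r18's TYPED `u₁`** (`u1bg`, the p. 270 display with ALL THREE factors:
`Q^{s*}v` on `Λ₁*`, `u^{(0)} = e^{ie₀A^{(0)}}` off `Λ₆*`, the (3.27) correction phase on `Λ₄*`): for the block field `v = Qu` of the
unit-lattice field `u` (any gauge) and `ū₁(b′) = Π_{s<L} u₁(b_s)` along the straight line of `b′` — defined for the bonds `b′ ∈ Λ′*` whose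
lines lie in `Λ₁*` (`hline`; print: `Λ₀′ ⊂ Λ₁`-type margin) — if (3.15) holds at the objects of record (file 1's hypotheses verbatim),
`|A^{(0)}| ≤ a` on the line bonds outside `Λ₆*` ((3.33)), `L^{−2}|corr| ≤ κ` on the line bonds inside `Λ₄*` and `L·e₀(a + κ) ≤ λ₀^{1/4}`, then
`SmallBlock332 (2·17d²L²) e₀ p(e₀) λ₀ Λ′ v(∂·) ψ (D_{ū₁}ψ)`. [cite: BalabanImbrieJaffe1988, (3.32) p.270] -/
theorem smallBlock332_u1bgBar_of_smallField315 (h1 : 1 ≤ P.m + P.K) (U : GaugeField P 0 U1)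
    {e₀ pe₀ lam₀ : ℝ} (he : 0 < e₀) (hpe : 0 ≤ pe₀) (hlam : 0 < lam₀) (hlam1 : lam₀ ≤ 1)
    (hπ : 17 * (P.d : ℝ) ^ 2 * (P.L : ℝ) ^ 2 * (e₀ * pe₀) < π)
    (hsm : 2 * (17 * (P.d : ℝ) ^ 2 * (P.L : ℝ) ^ 2) * (e₀ * pe₀) ≤ lam₀ ^ (1 / 4 : ℝ))
    {Λ : Finset (Balaban1983to89.Site P 0)} {Λ' : Finset (Balaban1983to89.Site P 1)}
    (hΛ₁ : ∀ x : Balaban1983to89.Site P 0, blockOf x ∈ Λ' → x ∈ Λ)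
    (hΛ₂ : ∀ p : Balaban1983to89.Plaq P 0, blockOf p.src ∈ Λ' → p ∈ starP Λ)
    {ψ : Balaban1983to89.Site P 1 → ℂ} {φ : HiggsField P 0} {c' : ℝ} (hc0 : 0 ≤ c') (hc1 : c' ≤ 1)
    (h : SmallField315 pe₀ lam₀ Λ Λ' (covD 1 (cfg U) φ) ψ (qCov U φ) φ (fun p => ‖fieldStrength e₀ (plaqVar (cfg U) p)‖))
    {Λ₁s Λ₄s Λ₆s : Finset (PBond P 0)} (L : ℝ) (A0 corr : PBond P 0 → ℝ) {a κ : ℝ} (ha : 0 ≤ a) (hκ : 0 ≤ κ)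
    (hline : ∀ b' ∈ starB Λ', ∀ s < P.L, (⟨LatticeFieldCalculus.runSite (embIter 1 b'.src) b'.dir s, b'.dir⟩ : PBond P 0) ∈ Λ₁s)
    (hA : ∀ b' ∈ starB Λ', ∀ s < P.L, (⟨LatticeFieldCalculus.runSite (embIter 1 b'.src) b'.dir s, b'.dir⟩ : PBond P 0) ∉ Λ₆s →
      |A0 ⟨LatticeFieldCalculus.runSite (embIter 1 b'.src) b'.dir s, b'.dir⟩| ≤ a)
    (hK : ∀ b' ∈ starB Λ', ∀ s < P.L, (⟨LatticeFieldCalculus.runSite (embIter 1 b'.src) b'.dir s, b'.dir⟩ : PBond P 0) ∈ Λ₄s →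
      L ^ (-(2 : ℤ)) * |corr ⟨LatticeFieldCalculus.runSite (embIter 1 b'.src) b'.dir s, b'.dir⟩| ≤ κ)
    (hsm' : (P.L : ℝ) * (e₀ * a + e₀ * κ) ≤ lam₀ ^ (1 / 4 : ℝ)) :
    SmallBlock332 (2 * (17 * (P.d : ℝ) ^ 2 * (P.L : ℝ) ^ 2)) e₀ pe₀ lam₀ Λ' (plaqVar (cfg (qU U))) ψ
      (covD c' (fun c : PBond P 1 => ∏ s ∈ range P.L,
        u1bg Λ₁s Λ₄s Λ₆s (cfg (qsstarG (qU U))) e₀ L A0 corr ⟨LatticeFieldCalculus.runSite (embIter 1 c.src) c.dir s, c.dir⟩) ψ) :=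
  smallBlock332_perturb (by positivity) he.le hpe hlam hc0 hc1
    (smallBlock332_of_smallField315_all h1 U he hpe hlam hlam1 hπ hsm hΛ₁ hΛ₂ hc0 hc1 h) _
    (mul_nonneg (Nat.cast_nonneg _) (add_nonneg (mul_nonneg he.le ha) (mul_nonneg he.le hκ)))
    (fun b' hb' => norm_prod_u1bg_line_sub_le h1 he.le ha hκ A0 corr (qU U) (hline b' hb') (hA b' hb') (hK b' hb'))
    hsm'

/-! ## §4  THE CORRECTION OF RECORD: p29's `w327`/`corr327`, p27's size, the dictionary with `u1bg`, the assembled clause -/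

/-- kernel: p29's correction factor read in `ℂ`: `w₃₂₇(v)(b) = exp(−ie₀(D^{(0)}f)(b))`. [cite: BalabanImbrieJaffe1988, (3.28) p.270] -/
theorem toC_w327 (hd : 2 ≤ P.d) (R L e₀ : ℝ) (Λ₄s : Finset (PBond P 0)) (V : GaugeField P 1 U1) (b : PBond P 0) :
    toC (w327 hd R L e₀ Λ₄s V b) =
      Complex.exp (((-(e₀ * 1 * D327 hd R L Λ₄s (fun p => fieldStrength e₀ (plaqVar (cfg V) p)) b) : ℝ) : ℂ) * I) := by
  show toC (expU1 _) = _
  rw [toC_expU1]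

/-- **`|w₃₂₇(v)(b) − 1| ≤ e₀·|(D^{(0)}f)(b)|`**, i.e. `≤ e₀L^{−2}|corr₃₂₇(b)|` inside `Λ₄*` and `= 0` outside (p29's `D327_fieldStrength`).
[cite: BalabanImbrieJaffe1988, (3.28) p.270] -/
theorem norm_toC_w327_sub_one_le (hd : 2 ≤ P.d) (R L : ℝ) {e₀ : ℝ} (he : 0 ≤ e₀) (Λ₄s : Finset (PBond P 0)) (V : GaugeField P 1 U1)
    (b : PBond P 0) :
    ‖toC (w327 hd R L e₀ Λ₄s V b) - 1‖ ≤ e₀ * |if b ∈ Λ₄s then L ^ (-(2 : ℤ)) * corr327 hd R e₀ (cfg V) b else 0| := by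
  rw [toC_w327, ← D327_fieldStrength hd R L e₀ Λ₄s V b]
  refine (norm_cexp_mul_I_sub_one_le _).trans (le_of_eq ?_)
  rw [abs_neg, mul_one, abs_mul, abs_of_nonneg he]

/-- off `Λ₄*` there is no correction: `w₃₂₇(v)(b) = 1` in `ℂ`. [cite: BalabanImbrieJaffe1988, (3.27) p.269] -/
theorem toC_w327_of_not_mem (hd : 2 ≤ P.d) (R L e₀ : ℝ) {Λ₄s : Finset (PBond P 0)} (V : GaugeField P 1 U1) {b : PBond P 0}
    (hb : b ∉ Λ₄s) : toC (w327 hd R L e₀ Λ₄s V b) = 1 := by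
  rw [toC_w327, D327_fieldStrength, if_neg hb]
  simp

/-- **THE SIZE OF THE CORRECTION FACTOR OF RECORD** (p27's `abs_clocCorr_le_of_bound` BY NAME): under a kernel bound
`|C^{(0)}_{loc}(b,b′)| ≤ Me^{−δ|b−b′|_∞}` and `|f(q)| ≤ c₂p(e₀)` for the field strengths (3.26) of `v` on the coarse plaquettes based at blocks
met within sup-distance `R + 4L + 1` of `b₋`: `|w₃₂₇(v)(b) − 1| ≤ e₀·M·d(2(1+d/δ))^d·4d·c₂·p(e₀)` (print's `L`: `L = P.L`).
[cite: BalabanImbrieJaffe1988, (3.28) p.270] -/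
theorem norm_toC_w327_sub_one_le_of_bound (h1 : 1 ≤ P.m + P.K) (hd : 2 ≤ P.d) {M δ : ℝ} (hM : 0 ≤ M) (hδ : 0 < δ) {R : ℝ}
    (hC : ∀ b b' : PBond P 0, |Cloc P 0 R b b'| ≤ M * Real.exp (-(δ * distB P 0 b b')))
    {e₀ c₂ pe₀ : ℝ} (he : 0 ≤ e₀) (hc₂ : 0 ≤ c₂) (hpe : 0 ≤ pe₀) (Λ₄s : Finset (PBond P 0)) (V : GaugeField P 1 U1) (b : PBond P 0)
    (hf : ∀ q : Balaban1983to89.Plaq P 1,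
      (∃ x : Balaban1983to89.Site P 0, (supDist b.src x : ℝ) ≤ R + 4 * P.L + 1 ∧ blockOf x = q.src) → |f326 e₀ (cfg V) q| ≤ c₂ * pe₀) :
    ‖toC (w327 hd R (P.L : ℝ) e₀ Λ₄s V b) - 1‖ ≤ e₀ * (M * ((P.d : ℝ) * (2 * (1 + P.d / δ)) ^ P.d) * (4 * P.d) * c₂) * pe₀ := by
  refine (norm_toC_w327_sub_one_le hd R _ he Λ₄s V b).trans ?_
  have hX : 0 ≤ M * ((P.d : ℝ) * (2 * (1 + P.d / δ)) ^ P.d) * (4 * P.d) := by positivity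
  split_ifs with hb
  · have hcorr : |corr327 hd R e₀ (cfg V) b| ≤ M * ((P.d : ℝ) * (2 * (1 + P.d / δ)) ^ P.d) * (4 * P.d) * ((P.L : ℝ) ^ 2 * (c₂ * pe₀)) := by
      rw [corr327_eq_mulVec]
      exact abs_clocCorr_le_of_bound h1 hd hM hδ hC (f326 e₀ (cfg V)) b (mul_nonneg hc₂ hpe) hf
    have hL : (0 : ℝ) < (P.L : ℝ) := P.cast_L_pos
    have hL2 : 0 ≤ (P.L : ℝ) ^ (-(2 : ℤ)) := by positivity
    rw [abs_mul, abs_of_nonneg hL2]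
    calc e₀ * ((P.L : ℝ) ^ (-(2 : ℤ)) * |corr327 hd R e₀ (cfg V) b|)
        ≤ e₀ * ((P.L : ℝ) ^ (-(2 : ℤ)) * (M * ((P.d : ℝ) * (2 * (1 + P.d / δ)) ^ P.d) * (4 * P.d) * ((P.L : ℝ) ^ 2 * (c₂ * pe₀)))) :=
          mul_le_mul_of_nonneg_left (mul_le_mul_of_nonneg_left hcorr hL2) he
      _ = e₀ * (M * ((P.d : ℝ) * (2 * (1 + P.d / δ)) ^ P.d) * (4 * P.d) * c₂) * pe₀ := by
          rw [zpow_neg, zpow_ofNat]; field_simp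
  · rw [abs_zero, mul_zero]; positivity

/-- **DICTIONARY**: on a bond `b′` whose straight line lies in `Λ₁* ∩ Λ₆*`, print's `ū₁(b′)` of the (4.2)-shaped background of record
`bg42 1 w₃₂₇ v` IS the line product of r18's typed `u₁` (`u1bg` with `Q^{s*}v = cfg (qsstarG v)` and the composed correction `corr327`; p29's
bridge `u1bg_corr327_eq_cfg_bg42` bondwise + `toC_barU`). [cite: BalabanImbrieJaffe1988, (3.28) p.270] -/
theorem cfg_barU_bg42_w327_eq_prod_u1bg (h1 : 1 ≤ P.m + P.K) (hd : 2 ≤ P.d) (R L e₀ : ℝ) {Λ₁s Λ₄s Λ₆s : Finset (PBond P 0)}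
    (A0 : PBond P 0 → ℝ) (V : GaugeField P 1 U1) {c : PBond P 1}
    (hc₁ : ∀ s < P.L, (⟨LatticeFieldCalculus.runSite (embIter 1 c.src) c.dir s, c.dir⟩ : PBond P 0) ∈ Λ₁s)
    (hc₆ : ∀ s < P.L, (⟨LatticeFieldCalculus.runSite (embIter 1 c.src) c.dir s, c.dir⟩ : PBond P 0) ∈ Λ₆s) :
    cfg (barU 1 (bg42 1 (w327 hd R L e₀ Λ₄s) V)) c =
      ∏ s ∈ range P.L, u1bg Λ₁s Λ₄s Λ₆s (cfg (qsstarG V)) e₀ L A0 (corr327 hd R e₀ (cfg V))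
        ⟨LatticeFieldCalculus.runSite (embIter 1 c.src) c.dir s, c.dir⟩ := by
  show toC (barU 1 _ c) = _
  rw [toC_barU h1, pow_one]
  refine prod_congr rfl fun s hs => ?_
  rw [u1bg_corr327_eq_cfg_bg42 hd R L e₀ A0 V (hc₁ s (mem_range.1 hs)) (hc₆ s (mem_range.1 hs))]
  rfl

/-- kernel: `|f(q)| ≤ ‖(ie₀)^{−1}log v(∂q)‖` — p29's real reading (3.26) is dominated by r18's principal-branch field strength, so p31's
`SmallF c₂ p(e₀) e₀ Λ₀′ v(∂·)` ((5.3.1)-shape: `‖f‖ ≤ c₂p(e₀)` on `Λ₀′**`) feeds the hypotheses below. [cite: BalabanImbrieJaffe1988, (3.26) p.269] -/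
theorem abs_f326_le_of_smallF {c₂ pe₀ e₀ : ℝ} {Λ₀' : Finset (Balaban1983to89.Site P 1)} {V : GaugeField P 1 U1}
    (hF : SmallF c₂ pe₀ e₀ Λ₀' (fun q => toC (plaqHol V q))) {q : Balaban1983to89.Plaq P 1} (hq : q ∈ starP Λ₀') :
    |f326 e₀ (cfg V) q| ≤ c₂ * pe₀ := by
  have h := hF q hq
  dsimp only at h
  rw [← plaqVar_cfg] at h
  exact (Complex.abs_re_le_norm _).trans h

/-- **(3.15) ⟹ (3.32) WITH PRINT'S `ū₁` AT THE BACKGROUND OF RECORD** `u₁ = (Q^{s*}v)·exp(−ie₀Λ₄*L^{−2}C^{(0)}_{loc}∂*Q^{e*}f)` (the p. 270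
display on `Λ₁* ∩ Λ₆*`: p34's `bg42 1 w₃₂₇ v` = r18's `u1bg` there by `cfg_barU_bg42_w327_eq_prod_u1bg`), `ū₁ = barU 1 u₁` ((4.4)), `v = Qu`:
under file 1's (3.15)-hypotheses, a kernel bound `|C^{(0)}_{loc}(b,b′)| ≤ Me^{−δ|b−b′|_∞}` (p09's (7.2.3), hypothesis here as in p27's file),
`|f(q)| ≤ c₂p(e₀)` for the field strengths of `v` near the lines of `Λ′*` (located, p27's shape) and the smallness
`L·e₀·M·d(2(1+d/δ))^d·4d·c₂·p(e₀) ≤ λ₀^{1/4}`: `SmallBlock332 (2·17d²L²) e₀ p(e₀) λ₀ Λ′ v(∂·) ψ (D_{ū₁}ψ)`.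
[cite: BalabanImbrieJaffe1988, (3.32) p.270] -/
theorem smallBlock332_u1bar_of_smallField315 (h1 : 1 ≤ P.m + P.K) (hd : 2 ≤ P.d) {M δ : ℝ} (hM : 0 ≤ M) (hδ : 0 < δ) {R : ℝ}
    (hC : ∀ b b' : PBond P 0, |Cloc P 0 R b b'| ≤ M * Real.exp (-(δ * distB P 0 b b')))
    (U : GaugeField P 0 U1) {e₀ pe₀ lam₀ : ℝ} (he : 0 < e₀) (hpe : 0 ≤ pe₀) (hlam : 0 < lam₀) (hlam1 : lam₀ ≤ 1)
    (hπ : 17 * (P.d : ℝ) ^ 2 * (P.L : ℝ) ^ 2 * (e₀ * pe₀) < π)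
    (hsm : 2 * (17 * (P.d : ℝ) ^ 2 * (P.L : ℝ) ^ 2) * (e₀ * pe₀) ≤ lam₀ ^ (1 / 4 : ℝ))
    {Λ : Finset (Balaban1983to89.Site P 0)} {Λ' : Finset (Balaban1983to89.Site P 1)}
    (hΛ₁ : ∀ x : Balaban1983to89.Site P 0, blockOf x ∈ Λ' → x ∈ Λ)
    (hΛ₂ : ∀ p : Balaban1983to89.Plaq P 0, blockOf p.src ∈ Λ' → p ∈ starP Λ)
    {ψ : Balaban1983to89.Site P 1 → ℂ} {φ : HiggsField P 0} {c' : ℝ} (hc0 : 0 ≤ c') (hc1 : c' ≤ 1)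
    (h : SmallField315 pe₀ lam₀ Λ Λ' (covD 1 (cfg U) φ) ψ (qCov U φ) φ (fun p => ‖fieldStrength e₀ (plaqVar (cfg U) p)‖))
    (Λ₄s : Finset (PBond P 0)) {c₂ : ℝ} (hc₂ : 0 ≤ c₂)
    (hf : ∀ b' ∈ starB Λ', ∀ s < P.L, ∀ q : Balaban1983to89.Plaq P 1,
      (∃ x : Balaban1983to89.Site P 0, (supDist (LatticeFieldCalculus.runSite (embIter 1 b'.src) b'.dir s) x : ℝ) ≤ R + 4 * P.L + 1 ∧
        blockOf x = q.src) → |f326 e₀ (cfg (qU U)) q| ≤ c₂ * pe₀)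
    (hsm' : (P.L : ℝ) * (e₀ * (M * ((P.d : ℝ) * (2 * (1 + P.d / δ)) ^ P.d) * (4 * P.d) * c₂) * pe₀) ≤ lam₀ ^ (1 / 4 : ℝ)) :
    SmallBlock332 (2 * (17 * (P.d : ℝ) ^ 2 * (P.L : ℝ) ^ 2)) e₀ pe₀ lam₀ Λ' (plaqVar (cfg (qU U))) ψ
      (covD c' (cfg (barU 1 (bg42 1 (w327 hd R (P.L : ℝ) e₀ Λ₄s) (qU U)))) ψ) :=
  smallBlock332_ubar_of_smallField315 h1 U he hpe hlam hlam1 hπ hsm hΛ₁ hΛ₂ hc0 hc1 h (w327 hd R (P.L : ℝ) e₀ Λ₄s)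
    (by positivity)
    (fun b' hb' s hs => norm_toC_w327_sub_one_le_of_bound h1 hd hM hδ hC he.le hc₂ hpe Λ₄s (qU U) _ (hf b' hb' s hs))
    hsm'

/-- **The same, fed by p31's `SmallF`** (`|f(q)| ≤ c₂p(e₀)` on `Λ₀′**` for the block field `v = Qu` — p31's `smallF_of_plaquettes` gives
`c₂ = 17d²L²` from the restrictions on the fine plaquette variables) **and the located margin** «every coarse plaquette based at a block met
within sup-distance `R + 4L + 1` of a line bond of `Λ′*` lies in `Λ₀′**`» (print: `Λ₁^{(0)}` is `Λ₀^{(0)}` with `r(e₀)`-cubes deleted, `R = ¼r(e₀)`).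
[cite: BalabanImbrieJaffe1988, (3.32) p.270] -/
theorem smallBlock332_u1bar_of_smallField315_of_smallF (h1 : 1 ≤ P.m + P.K) (hd : 2 ≤ P.d) {M δ : ℝ} (hM : 0 ≤ M) (hδ : 0 < δ) {R : ℝ}
    (hC : ∀ b b' : PBond P 0, |Cloc P 0 R b b'| ≤ M * Real.exp (-(δ * distB P 0 b b')))
    (U : GaugeField P 0 U1) {e₀ pe₀ lam₀ : ℝ} (he : 0 < e₀) (hpe : 0 ≤ pe₀) (hlam : 0 < lam₀) (hlam1 : lam₀ ≤ 1)
    (hπ : 17 * (P.d : ℝ) ^ 2 * (P.L : ℝ) ^ 2 * (e₀ * pe₀) < π)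
    (hsm : 2 * (17 * (P.d : ℝ) ^ 2 * (P.L : ℝ) ^ 2) * (e₀ * pe₀) ≤ lam₀ ^ (1 / 4 : ℝ))
    {Λ : Finset (Balaban1983to89.Site P 0)} {Λ' : Finset (Balaban1983to89.Site P 1)}
    (hΛ₁ : ∀ x : Balaban1983to89.Site P 0, blockOf x ∈ Λ' → x ∈ Λ)
    (hΛ₂ : ∀ p : Balaban1983to89.Plaq P 0, blockOf p.src ∈ Λ' → p ∈ starP Λ)
    {ψ : Balaban1983to89.Site P 1 → ℂ} {φ : HiggsField P 0} {c' : ℝ} (hc0 : 0 ≤ c') (hc1 : c' ≤ 1)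
    (h : SmallField315 pe₀ lam₀ Λ Λ' (covD 1 (cfg U) φ) ψ (qCov U φ) φ (fun p => ‖fieldStrength e₀ (plaqVar (cfg U) p)‖))
    (Λ₄s : Finset (PBond P 0)) {c₂ : ℝ} (hc₂ : 0 ≤ c₂) {Λ₀' : Finset (Balaban1983to89.Site P 1)}
    (hF : SmallF c₂ pe₀ e₀ Λ₀' (fun q => toC (plaqHol (qU U) q)))
    (hmargin : ∀ b' ∈ starB Λ', ∀ s < P.L, ∀ x : Balaban1983to89.Site P 0,
      (supDist (LatticeFieldCalculus.runSite (embIter 1 b'.src) b'.dir s) x : ℝ) ≤ R + 4 * P.L + 1 →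
        ∀ q : Balaban1983to89.Plaq P 1, q.src = blockOf x → q ∈ starP Λ₀')
    (hsm' : (P.L : ℝ) * (e₀ * (M * ((P.d : ℝ) * (2 * (1 + P.d / δ)) ^ P.d) * (4 * P.d) * c₂) * pe₀) ≤ lam₀ ^ (1 / 4 : ℝ)) :
    SmallBlock332 (2 * (17 * (P.d : ℝ) ^ 2 * (P.L : ℝ) ^ 2)) e₀ pe₀ lam₀ Λ' (plaqVar (cfg (qU U))) ψ
      (covD c' (cfg (barU 1 (bg42 1 (w327 hd R (P.L : ℝ) e₀ Λ₄s) (qU U)))) ψ) :=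
  smallBlock332_u1bar_of_smallField315 h1 hd hM hδ hC U he hpe hlam hlam1 hπ hsm hΛ₁ hΛ₂ hc0 hc1 h Λ₄s hc₂
    (fun b' hb' s hs q ⟨x, hx, hq⟩ => abs_f326_le_of_smallF hF (hmargin b' hb' s hs x hx q hq.symm)) hsm'

/-! ## §5 (v1.1, append-only)  `ū` of the untranslated field `u` against `v = Qu` (axial gauge), and the UNIFORM form `u₁ = u·Y` -/

/-- kernel: `|u(Γ_{xx′})| = 1`. [cite: BalabanImbrieJaffe1985, (2.10) p.303] -/
private theorem norm_runC_eq_one' (U : GaugeField P 0 U1) (x : Balaban1983to89.Site P 0) (μ : Fin P.d) : ‖runC U x μ‖ = 1 := by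
  rw [runC, norm_prod]
  exact prod_eq_one fun _ _ => norm_toC _

/-- kernel: the loop constant `N₃` of p31's `abs_argB_loopC_le` is at most `17d²L²` (p31's `const_le_seventeen`). [folklore] -/
private theorem loopConst_le_C :
    (((P.L - 1) * ((P.d - 1) * (P.L - 1)) + (P.d - 1) * (P.L - 1) * (1 + 2 * ((P.d - 1) * (P.L - 1))) : ℕ) : ℝ) ≤
      17 * (P.d : ℝ) ^ 2 * (P.L : ℝ) ^ 2 := by
  have h := const_le_seventeen (P := P)
  have h' : (P.L - 1) * ((P.d - 1) * (P.L - 1)) + (P.d - 1) * (P.L - 1) * (1 + 2 * ((P.d - 1) * (P.L - 1))) ≤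
      17 * P.d ^ 2 * P.L ^ 2 := by omega
  exact_mod_cast h'

/-- **The centre-line product of `u` is its (2.10) block average up to the loop phases** (axial gauge `δ_{Ax}` of (3.11), where
`u(Γ_{y·}) = 1` on the block trees): for `b′ = ⟨y, y + e_μ⟩`, `ū(b′) = u(Γ_{xx′})` along the straight line from the centre `x` of `B(y)`,
`u(Γ_{xx′}) = u(loop_x)·e^{−i·loopAvg(b′)}·v(b′)` (`toC_qU`; `loopC` with `holC = 1`), hence
`|ū(b′) − v(b′)| ≤ |argB u(loop_x)| + |loopAvg(b′)| ≤ 2Nε` when `|arg u(p)| ≤ ε` on the plaquettes of the two blocks and `Nε < π`, `N ≥ N₃`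
(p31's `abs_argB_loopC_le`, `abs_loopAvg_le`). This is print's `u₁ = u` OFF `Λ₁*` ((3.24): no translation there).
[cite: BalabanImbrieJaffe1985, (2.10) p.303] -/
theorem norm_cfg_barU_sub_qU_le (h1 : 1 ≤ P.m + P.K) {U : GaugeField P 0 U1} (hU : DeltaAx U) {ε N : ℝ} (hε₀ : 0 ≤ ε)
    (hN : (((P.L - 1) * ((P.d - 1) * (P.L - 1)) + (P.d - 1) * (P.L - 1) * (1 + 2 * ((P.d - 1) * (P.L - 1))) : ℕ) : ℝ) ≤ N)
    (y : Balaban1983to89.Site P 1) (μ : Fin P.d)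
    (hε : ∀ p : Balaban1983to89.Plaq P 0, blockOf p.src = y ∨ blockOf p.src = y.shift μ → |argB (toC (plaqHol U p))| ≤ ε)
    (hπ : N * ε < π) :
    ‖cfg (barU 1 U) ⟨y, μ⟩ - cfg (qU U) ⟨y, μ⟩‖ ≤ 2 * N * ε := by
  set N₃ : ℝ := (((P.L - 1) * ((P.d - 1) * (P.L - 1)) + (P.d - 1) * (P.L - 1) * (1 + 2 * ((P.d - 1) * (P.L - 1))) : ℕ) : ℝ)
    with hN₃
  have hNε : N₃ * ε ≤ N * ε := mul_le_mul_of_nonneg_right hN hε₀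
  have hπ₃ : N₃ * ε < π := lt_of_le_of_lt hNε hπ
  -- the centre `x` of `B(y)`; `ū(b′)` is the run product `u(Γ_{xx′})` of [2] (2.10)
  set x : Balaban1983to89.Site P 0 := emb y with hx
  have hxy : blockOf x = y := Balaban1983to89.Site.blockOf_emb h1 y
  have hbar : cfg (barU 1 U) ⟨y, μ⟩ = runC U x μ := by
    show toC (barU 1 U _) = _
    rw [toC_barU h1, pow_one]
    rfl
  -- in the axial gauge the loop at `x` is `u(Γ_{xx′})·u(Γ_{yy′})⁻¹`
  have hloopC : loopC U ⟨y, μ⟩ x = runC U x μ * (runC U (corner y) μ)⁻¹ := by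
    simp only [loopC, holC_of_deltaAx h1 hU, one_mul, inv_one, mul_one]
  have hw1 : ‖loopC U ⟨y, μ⟩ x‖ = 1 := by
    rw [hloopC, norm_mul, norm_inv, norm_runC_eq_one', norm_runC_eq_one', inv_one, mul_one]
  have hv : cfg (qU U) ⟨y, μ⟩ = runC U (corner y) μ * Complex.exp ((loopAvg U ⟨y, μ⟩ : ℂ) * I) := toC_qU U _
  have hrun : runC U x μ = loopC U ⟨y, μ⟩ x * Complex.exp (-((loopAvg U ⟨y, μ⟩ : ℂ) * I)) * cfg (qU U) ⟨y, μ⟩ := by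
    rw [hv, hloopC, Complex.exp_neg]
    have h1' := runC_ne_zero U (corner y) μ
    have h2' := Complex.exp_ne_zero ((loopAvg U ⟨y, μ⟩ : ℂ) * I)
    field_simp
  have hα : |loopAvg U ⟨y, μ⟩| ≤ N₃ * ε := abs_loopAvg_le h1 hU hε₀ hε hπ₃
  have hloop : |argB (loopC U ⟨y, μ⟩ x)| ≤ N₃ * ε := by
    have ex : x = Balaban1983to89.Site.blockSite y (offs x) := by rw [← hxy, blockSite_offs h1]
    rw [ex]
    exact abs_argB_loopC_le h1 hU hε₀ hε hπ₃ (offs x)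
  have hfac : loopC U ⟨y, μ⟩ x * Complex.exp (-((loopAvg U ⟨y, μ⟩ : ℂ) * I)) =
      Complex.exp (((argB (loopC U ⟨y, μ⟩ x) - loopAvg U ⟨y, μ⟩ : ℝ) : ℂ) * I) := by
    rw [ofReal_sub, sub_mul, Complex.exp_sub, exp_argB_mul_I_of_norm hw1, div_eq_mul_inv, Complex.exp_neg]
  rw [hbar, hrun, show loopC U ⟨y, μ⟩ x * Complex.exp (-((loopAvg U ⟨y, μ⟩ : ℂ) * I)) * cfg (qU U) ⟨y, μ⟩ - cfg (qU U) ⟨y, μ⟩ =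
      (loopC U ⟨y, μ⟩ x * Complex.exp (-((loopAvg U ⟨y, μ⟩ : ℂ) * I)) - 1) * cfg (qU U) ⟨y, μ⟩ by ring, norm_mul,
    show ‖cfg (qU U) ⟨y, μ⟩‖ = 1 from norm_toC _, mul_one, hfac]
  refine (norm_cexp_mul_I_sub_one_le _).trans ?_
  calc |argB (loopC U ⟨y, μ⟩ x) - loopAvg U ⟨y, μ⟩| ≤ |argB (loopC U ⟨y, μ⟩ x)| + |loopAvg U ⟨y, μ⟩| := abs_sub _ _
    _ ≤ N₃ * ε + N₃ * ε := add_le_add hloop hα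
    _ ≤ N * ε + N * ε := add_le_add hNε hNε
    _ = 2 * N * ε := by ring

/-- **`ū` of a product is the product of the `ū`'s, read in `ℂ`** (abelian; p34's `barU_mul`). [cite: BalabanImbrieJaffe1988, (4.4) p.274] -/
theorem cfg_barU_mul (h1 : 1 ≤ P.m + P.K) (U Y : GaugeField P 0 U1) (c : PBond P 1) :
    cfg (barU 1 (fun b => U b * Y b)) c = cfg (barU 1 U) c * toC (barU 1 Y c) := by
  show toC (barU 1 (fun b => U b * Y b) c) = toC (barU 1 U c) * toC (barU 1 Y c)
  rw [barU_mul h1 U Y]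
  exact toC_mul _ _

/-- **(3.15) ⟹ (3.32) WITH PRINT'S `ū₁`, UNIFORM FORM `u₁ = u·Y`** (p. 270: off `Λ₁*` the background IS the untranslated field,
`u₁ = u^{(0)} = u′ = u` by (3.24)/(3.27), i.e. `Y = 1`; on `Λ₁*`, `u₁ = (Q^{s*}v)·Z = u·(u′)^{−1}·Z` with `u′ = e^{ie₀A′}`, `|A′| ≦ cp(e₀)`
(p. 269), i.e. `Y = (u′)^{−1}Z`): for the unit-lattice field `u` IN THE AXIAL GAUGE `δ_{Ax}` of (3.11) and ANY `U(1)` field `Y` with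
`|Y(b_s) − 1| ≤ δ` on the `L` line bonds of every `b′ ∈ Λ′*`, under file 1's (3.15)-hypotheses and the regime
`2·17d²L²·e₀p(e₀) + Lδ ≤ λ₀^{1/4}`: `SmallBlock332 (2·17d²L²) e₀ p(e₀) λ₀ Λ′ v(∂·) ψ (D_{ū₁}ψ)` at `ū₁ = barU 1 (u·Y)` — NO RESTRICTION on where
the lines of `Λ′*` lie (`|ū(b′) − v(b′)| ≤ 2·17d²L²·e₀p(e₀)` by `norm_cfg_barU_sub_qU_le`, `|ū(Y)(b′) − 1| ≤ Lδ` by §1).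
[cite: BalabanImbrieJaffe1988, (3.32) p.270] -/
theorem smallBlock332_ubarY_of_smallField315 (h1 : 1 ≤ P.m + P.K) {U : GaugeField P 0 U1} (hU : DeltaAx U)
    {e₀ pe₀ lam₀ : ℝ} (he : 0 < e₀) (hpe : 0 ≤ pe₀) (hlam : 0 < lam₀) (hlam1 : lam₀ ≤ 1)
    (hπ : 17 * (P.d : ℝ) ^ 2 * (P.L : ℝ) ^ 2 * (e₀ * pe₀) < π)
    (hsm : 2 * (17 * (P.d : ℝ) ^ 2 * (P.L : ℝ) ^ 2) * (e₀ * pe₀) ≤ lam₀ ^ (1 / 4 : ℝ))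
    {Λ : Finset (Balaban1983to89.Site P 0)} {Λ' : Finset (Balaban1983to89.Site P 1)}
    (hΛ₁ : ∀ x : Balaban1983to89.Site P 0, blockOf x ∈ Λ' → x ∈ Λ)
    (hΛ₂ : ∀ p : Balaban1983to89.Plaq P 0, blockOf p.src ∈ Λ' → p ∈ starP Λ)
    {ψ : Balaban1983to89.Site P 1 → ℂ} {φ : HiggsField P 0} {c' : ℝ} (hc0 : 0 ≤ c') (hc1 : c' ≤ 1)
    (h : SmallField315 pe₀ lam₀ Λ Λ' (covD 1 (cfg U) φ) ψ (qCov U φ) φ (fun p => ‖fieldStrength e₀ (plaqVar (cfg U) p)‖))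
    (Y : GaugeField P 0 U1) {δ : ℝ} (hδ0 : 0 ≤ δ)
    (hY : ∀ b' ∈ starB Λ', ∀ s < P.L, ‖toC (Y ⟨LatticeFieldCalculus.runSite (embIter 1 b'.src) b'.dir s, b'.dir⟩) - 1‖ ≤ δ)
    (hreg : 2 * (17 * (P.d : ℝ) ^ 2 * (P.L : ℝ) ^ 2) * (e₀ * pe₀) + (P.L : ℝ) * δ ≤ lam₀ ^ (1 / 4 : ℝ)) :
    SmallBlock332 (2 * (17 * (P.d : ℝ) ^ 2 * (P.L : ℝ) ^ 2)) e₀ pe₀ lam₀ Λ' (plaqVar (cfg (qU U))) ψ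
      (covD c' (cfg (barU 1 (fun b => U b * Y b))) ψ) := by
  set C : ℝ := 17 * (P.d : ℝ) ^ 2 * (P.L : ℝ) ^ 2 with hC
  have hC0 : 0 ≤ C := by positivity
  have hε : 0 ≤ e₀ * pe₀ := mul_nonneg he.le hpe
  have hsmall := plaqSmall_of_smallField315 he h
  refine smallBlock332_perturb hC0 he.le hpe hlam hc0 hc1
    (smallBlock332_of_smallField315 h1 hU he hpe hlam hlam1 hπ hsm hΛ₁ hΛ₂ hc0 hc1 h) _
    (add_nonneg (by positivity : (0 : ℝ) ≤ 2 * C * (e₀ * pe₀)) (mul_nonneg (Nat.cast_nonneg _) hδ0)) (fun b' hb' => ?_) hreg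
  obtain ⟨hys, hyt⟩ := (mem_starB Λ' b').1 hb'
  -- plaquette smallness on the two blocks of `b′` from (3.15), clause 4, through the margin `hΛ₂`
  have hεb : ∀ p : Balaban1983to89.Plaq P 0, blockOf p.src = b'.src ∨ blockOf p.src = b'.src.shift b'.dir →
      |argB (toC (plaqHol U p))| ≤ e₀ * pe₀ := by
    intro p hp
    refine hsmall p (hΛ₂ p ?_)
    rcases hp with hp | hp
    · rw [hp]; exact hys
    · rw [hp]; exact hyt
  have hbar : ‖cfg (barU 1 U) b' - cfg (qU U) b'‖ ≤ 2 * C * (e₀ * pe₀) := by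
    rcases b' with ⟨y, μ⟩
    exact norm_cfg_barU_sub_qU_le h1 hU hε loopConst_le_C y μ hεb hπ
  have hYbar : ‖toC (barU 1 Y b') - 1‖ ≤ P.L * δ := norm_toC_barU_one_sub_one_le_of_le h1 Y b' (hY b' hb')
  have hn : ‖cfg (barU 1 U) b'‖ = 1 := norm_toC _
  rw [cfg_barU_mul h1,
    show cfg (barU 1 U) b' * toC (barU 1 Y b') - cfg (qU U) b' =
      cfg (barU 1 U) b' * (toC (barU 1 Y b') - 1) + (cfg (barU 1 U) b' - cfg (qU U) b') by ring]
  calc ‖cfg (barU 1 U) b' * (toC (barU 1 Y b') - 1) + (cfg (barU 1 U) b' - cfg (qU U) b')‖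
      ≤ ‖cfg (barU 1 U) b' * (toC (barU 1 Y b') - 1)‖ + ‖cfg (barU 1 U) b' - cfg (qU U) b'‖ := norm_add_le _ _
    _ ≤ P.L * δ + 2 * C * (e₀ * pe₀) := by rw [norm_mul, hn, one_mul]; exact add_le_add hYbar hbar
    _ = 2 * C * (e₀ * pe₀) + P.L * δ := add_comm _ _

/-! ## §6  (v1.1) The two located analytic inputs of §4 discharged by name: p31's `SmallF` from (3.15), p09's kernel bound on `C^{(0)}_{loc}` -/

section ByName

open BIJ88SmallBlockFields332 (qU_gaugeAct_holFix smallField315_gaugeAct_holFix)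
open BIJ88Eq531SmallF (smallF_of_plaquettes)
open BIJ88ClocEstimatesTorus (cloc_decay)
open BIJ85AxialGaugeFixTorus (deltaAx_gaugeAct_holFix)

/-- **(3.15)'s PLAQUETTE CLAUSE ⟹ p31's `SmallF` FOR THE BLOCK FIELD `v = Qu`, ANY GAUGE** (p. 267 *"|f^{(0)}(p)| ≦ p(e₀)"* on `Λ**`;
p. 269 (3.26) `f(p) = (ie₀)^{−1} log v(p)`): if `(u, φ, ψ)` satisfy (3.15) at the objects of record on `(Λ, Λ′)` and every fine plaquette
based in one of the four corner blocks of a coarse plaquette of `Λ₀′**` lies in `Λ**` (p31's located margin, verbatim), then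
`SmallF (17d²L²) p(e₀) e₀ Λ₀′ v(∂·)`, i.e. `‖(ie₀)^{−1}log v(∂q)‖ ≤ 17d²L²·p(e₀)` on `Λ₀′**` — p31's `smallF_of_plaquettes` (axial gauge) applied
to the axial representative `u^h`, `h(x) = u(Γ_{yx})` (file 1's `smallField315_gaugeAct_holFix`, `deltaAx_gaugeAct_holFix`), whose block field
is the same (`qU_gaugeAct_holFix`); regime `17d²L²e₀p(e₀) < π`.
[cite: BalabanImbrieJaffe1988, (3.15) p.267] [cite: BalabanImbrieJaffe1988, (3.26) p.269] -/
theorem smallF_of_smallField315 (h1 : 1 ≤ P.m + P.K) (U : GaugeField P 0 U1) {e₀ pe₀ lam₀ : ℝ} (he : 0 < e₀) (hpe : 0 ≤ pe₀)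
    (hπ : 17 * (P.d : ℝ) ^ 2 * (P.L : ℝ) ^ 2 * (e₀ * pe₀) < π)
    {Λ : Finset (Balaban1983to89.Site P 0)} {Λ' : Finset (Balaban1983to89.Site P 1)}
    {ψ : Balaban1983to89.Site P 1 → ℂ} {φ : HiggsField P 0}
    (h : SmallField315 pe₀ lam₀ Λ Λ' (covD 1 (cfg U) φ) ψ (qCov U φ) φ (fun p => ‖fieldStrength e₀ (plaqVar (cfg U) p)‖))
    (Λ₀' : Finset (Balaban1983to89.Site P 1))
    (hΛ₃ : ∀ q ∈ starP Λ₀', ∀ p : Balaban1983to89.Plaq P 0, blockOf p.src = q.src ∨ blockOf p.src = q.src.shift q.μ ∨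
      blockOf p.src = q.src.shift q.ν ∨ blockOf p.src = (q.src.shift q.μ).shift q.ν → p ∈ starP Λ) :
    SmallF (17 * (P.d : ℝ) ^ 2 * (P.L : ℝ) ^ 2) pe₀ e₀ Λ₀' (fun q => toC (plaqHol (qU U) q)) := by
  have hsmall := plaqSmall_of_smallField315 he (smallField315_gaugeAct_holFix h1 h)
  have key := smallF_of_plaquettes h1 (deltaAx_gaugeAct_holFix h1 U) he hpe Λ₀' (fun q hq p hp => hsmall p (hΛ₃ q hq p hp)) hπ
  rwa [qU_gaugeAct_holFix h1] at key

/-- **(3.15) ⟹ (3.32) WITH PRINT'S `ū₁`, THE KERNEL BOUND AND THE `|f|`-BOUND DISCHARGED BY NAME** (p. 270: *"In the small field region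
Λ₀^{(0)} we have small block fields … |(D_{ū₁}ψ)(b′)| ≦ cp(e₀), b′ ∈ Λ₀^{(0)′*} (3.32) where ū₁(b′) = ū₁(⟨b′₋, b′₊⟩)"*): for every dimension
`d ≥ 2` and block size `L ≥ 1` THERE IS `C > 0` (namely `C = M′·d(2(1 + d/δ′))^d·4d·17d²L²` with the constants `M′, δ′` of p09's
`BIJ88ClocEstimatesTorus.cloc_decay` — the (2.5)-analogue `|C^{(0)}_{loc}(b,b′)| ≤ M′e^{−δ′|b−b′|}` of [BalabanImbrieJaffe1985] (7.2.3), uniform in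
the torus and in the radius `R`) such that on every torus of the series with `P.d = d`, `P.L = L`, `1 ≤ m + K`, for every radius `R`, every
`U(1)` field `u` (any gauge), `0 < e₀`, `0 ≤ p(e₀)`, `0 < λ₀ ≤ 1` in the regimes `17d²L²e₀p(e₀) < π`, `2·17d²L²e₀p(e₀) ≤ λ₀^{1/4}`,
**`L·e₀·C·p(e₀) ≤ λ₀^{1/4}`**, every fine region `Λ` and coarse regions `Λ′`, `Λ₀′` with the LOCATED MARGINS of §4 (file 1's `hΛ₁`/`hΛ₂`: the
fine sites / plaquettes of the blocks of `Λ′` lie in `Λ` / `Λ**`; p31's four-corner-block clause for `Λ₀′`; every coarse plaquette based at a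
block met within sup-distance `R + 4L + 1` of a line bond of `Λ′*` lies in `Λ₀′**` — print's `Λ₀′ ⊂ Λ₀`, `Λ₁ = Λ₀` minus `r(e₀)`-cubes,
`R = ¼r(e₀)`), every `ψ, φ` and coarse prefactor `0 ≤ c′ ≤ 1` with (3.15) at the objects of record (r18's `SmallField315` BY NAME), and every
bond set `Λ₄*`: `SmallBlock332 (2·17d²L²) e₀ p(e₀) λ₀ Λ′ v(∂·) ψ (D_{ū₁}ψ)` with `v = Qu` and `ū₁ = barU 1 (bg42 1 (w327 hd R L e₀ Λ₄*) (Qu))`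
(the p. 270 background with p29's correction of record, §4) — §4's `smallBlock332_u1bar_of_smallField315_of_smallF` with `hC` := p09's
`cloc_decay` and `hF` := `smallF_of_smallField315`; NO analytic hypothesis is left.
[cite: BalabanImbrieJaffe1988, (3.32) p.270] [cite: BalabanImbrieJaffe1988, (3.15) p.267] [cite: BalabanImbrieJaffe1985, (7.2.3) p.325] -/
theorem smallBlock332_u1bar_byName (d L : ℕ) (hd : 2 ≤ d) (hL : 1 ≤ L) :
    ∃ C : ℝ, 0 < C ∧ ∀ (P : Params), P.d = d → P.L = L → ∀ (h1 : 1 ≤ P.m + P.K) (hd' : 2 ≤ P.d) (R : ℝ) (U : GaugeField P 0 U1)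
      {e₀ pe₀ lam₀ : ℝ}, 0 < e₀ → 0 ≤ pe₀ → 0 < lam₀ → lam₀ ≤ 1 →
      17 * (P.d : ℝ) ^ 2 * (P.L : ℝ) ^ 2 * (e₀ * pe₀) < π →
      2 * (17 * (P.d : ℝ) ^ 2 * (P.L : ℝ) ^ 2) * (e₀ * pe₀) ≤ lam₀ ^ (1 / 4 : ℝ) →
      (P.L : ℝ) * (e₀ * C * pe₀) ≤ lam₀ ^ (1 / 4 : ℝ) →
      ∀ {Λ : Finset (Balaban1983to89.Site P 0)} {Λ' Λ₀' : Finset (Balaban1983to89.Site P 1)},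
      (∀ x : Balaban1983to89.Site P 0, blockOf x ∈ Λ' → x ∈ Λ) →
      (∀ p : Balaban1983to89.Plaq P 0, blockOf p.src ∈ Λ' → p ∈ starP Λ) →
      (∀ q ∈ starP Λ₀', ∀ p : Balaban1983to89.Plaq P 0, blockOf p.src = q.src ∨ blockOf p.src = q.src.shift q.μ ∨
        blockOf p.src = q.src.shift q.ν ∨ blockOf p.src = (q.src.shift q.μ).shift q.ν → p ∈ starP Λ) →
      (∀ b' ∈ starB Λ', ∀ s < P.L, ∀ x : Balaban1983to89.Site P 0,
        (supDist (LatticeFieldCalculus.runSite (embIter 1 b'.src) b'.dir s) x : ℝ) ≤ R + 4 * P.L + 1 →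
          ∀ q : Balaban1983to89.Plaq P 1, q.src = blockOf x → q ∈ starP Λ₀') →
      ∀ {ψ : Balaban1983to89.Site P 1 → ℂ} {φ : HiggsField P 0} {c' : ℝ}, 0 ≤ c' → c' ≤ 1 →
      SmallField315 pe₀ lam₀ Λ Λ' (covD 1 (cfg U) φ) ψ (qCov U φ) φ (fun p => ‖fieldStrength e₀ (plaqVar (cfg U) p)‖) →
      ∀ (Λ₄s : Finset (PBond P 0)),
      SmallBlock332 (2 * (17 * (P.d : ℝ) ^ 2 * (P.L : ℝ) ^ 2)) e₀ pe₀ lam₀ Λ' (plaqVar (cfg (qU U))) ψ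
        (covD c' (cfg (barU 1 (bg42 1 (w327 hd' R (P.L : ℝ) e₀ Λ₄s) (qU U)))) ψ) := by
  obtain ⟨M', δ', hM', hδ', H⟩ := cloc_decay d L hd
  have hd0 : 0 < d := by omega
  have hL0 : 0 < L := by omega
  refine ⟨M' * ((d : ℝ) * (2 * (1 + d / δ')) ^ d) * (4 * d) * (17 * (d : ℝ) ^ 2 * (L : ℝ) ^ 2), by positivity, ?_⟩
  intro P hP hPL h1 hd' R U e₀ pe₀ lam₀ he hpe hlam hlam1 hπ hsm hsmC Λ Λ' Λ₀' hΛ₁ hΛ₂ hΛ₃ hmargin ψ φ c' hc0 hc1 h Λ₄s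
  subst hP hPL
  have hC : ∀ b b' : PBond P 0, |Cloc P 0 R b b'| ≤ M' * Real.exp (-(δ' * distB P 0 b b')) := fun b b' => by
    convert H P rfl rfl 0 inferInstance h1 R b b' using 2
  exact smallBlock332_u1bar_of_smallField315_of_smallF h1 hd' hM'.le hδ' hC U he hpe hlam hlam1 hπ hsm hΛ₁ hΛ₂ hc0 hc1 h Λ₄s
    (by positivity) (smallF_of_smallField315 h1 U he hpe hπ h Λ₀' hΛ₃) hmargin hsmC

/-- kernel: p29's correction of record is p27's matrix–vector composite at the field strengths of `v` (`f326` = `Re (ie₀)^{−1}log v(∂·)`,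
`plaqVar (cfg v) = v(∂·)`). [cite: BalabanImbrieJaffe1988, (3.27) p.269] -/
theorem corr327_cfg_eq_mulVec (hd : 2 ≤ P.d) (R e₀ : ℝ) (V : GaugeField P 1 U1) :
    corr327 hd R e₀ (cfg V) =
      (Cloc P 0 R).mulVec (plaqDiv 1 ((torusEdgeCells P 0 hd).Qstar (fun q => (fieldStrength e₀ (toC (plaqHol V q))).re))) := by
  rw [corr327_eq_mulVec]
  have hf : f326 e₀ (cfg V) = fun q => (fieldStrength e₀ (toC (plaqHol V q))).re := by
    funext q
    rw [BIJ88SecondTranslation327Torus.f326_apply, plaqVar_cfg]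
  rw [hf]

/-- **(3.15) ⟹ (3.32) AT r18's TYPED `u₁` WITH ALL THREE FACTORS (typing (B)), EVERY ANALYTIC INPUT DISCHARGED BY NAME** (p. 270:
*"|(D_{ū₁}ψ)(b′)| ≦ cp(e₀), b′ ∈ Λ₀^{(0)′*} (3.32) where ū₁(b′) = ū₁(⟨b′₋, b′₊⟩)"*, *"u₁ = (Λ₁^{(0)*}Q^{s*}v)(Λ₆^{(0)*c}u^{(0)})exp(ie₀Λ₄^{(0)*}L^{−2}
C^{(0)}_{loc}∂*Q^{e*}f). Here u^{(0)} = exp(ie₀A^{(0)}) … where |A^{(0)}| ≦ cp(e₀) in Λ₁^{(0)*} (3.33)"*): for `d ≥ 2`, `L ≥ 1` THERE IS `C > 0` on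
`(d, L)` only (`C = 6d²L² + 2·M′d(2(1+d/δ′))^d·4d·17d²L²`, p09's `(M′, δ′)`) such that on every torus with `P.d = d`, `P.L = L`, `1 ≤ m + K`, every
`R`, every `U(1)` field `u` in the axial gauge `δ_{Ax}` of (3.11), `0 < e₀`, `0 ≤ p(e₀)`, `0 < λ₀ ≤ 1` in the regimes `17d²L²e₀p < π`,
`2·17d²L²e₀p ≤ λ₀^{1/4}`, `L·e₀·C·p(e₀) ≤ λ₀^{1/4}`, all regions `Λ, Λ′, Λ₀′, Λ₁*, Λ₄*, Λ₆*` with the LOCATED MARGINS (file 1's `hΛ₁`/`hΛ₂`; the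
fine plaquettes of the two blocks of each bond of `Λ₁*` and of the four blocks around each coarse plaquette of `Λ₀′**` lie in `Λ**` — p31's /
p27's shapes; the `R + 4L + 1` collar of p27's §2 for the bonds of `Λ₁* ∩ Λ₄*`; the lines of `Λ′*` lie in `Λ₁*`), (3.15) at the objects of record,
and every `A^{(0)}` TIED TO PRINT'S `A′ = arg(u′)/e₀` BY (3.27) with the correction of record (p27's `h327` shape:
`Aprime327 Λ₄* L A^{(0)} corr₃₂₇ = arg(u′)/e₀`): `SmallBlock332 (2·17d²L²) e₀ p(e₀) λ₀ Λ′ v(∂·) ψ (D_{ū₁}ψ)` at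
`ū₁(b′) = Π_{s<L} u1bg Λ₁* Λ₄* Λ₆* (Q^{s*}v) e₀ L A^{(0)} corr₃₂₇ (b_s)` — §3's `smallBlock332_u1bgBar_of_smallField315` with `|A^{(0)}_b| ≤ a` := p27's
`small333_gauge_of_plaquettes` ((3.33) from the plaquette restrictions, p31's `smallAPrime_of_plaquettes` / `smallF_of_plaquettes` inside)
and `L^{−2}|corr(b)| ≤ κ` := p27's `abs_clocCorr_le_of_bound`, both over p09's `cloc_decay`; NO analytic hypothesis is left.
[cite: BalabanImbrieJaffe1988, (3.32) p.270] [cite: BalabanImbrieJaffe1988, (3.33) p.270] [cite: BalabanImbrieJaffe1988, (3.27) p.269]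
[cite: BalabanImbrieJaffe1985, (7.2.3) p.325] -/
theorem smallBlock332_u1bgBar_byName (d L : ℕ) (hd : 2 ≤ d) (hL : 1 ≤ L) :
    ∃ C : ℝ, 0 < C ∧ ∀ (P : Params), P.d = d → P.L = L → ∀ (h1 : 1 ≤ P.m + P.K) (hd' : 2 ≤ P.d) (R : ℝ) {U : GaugeField P 0 U1},
      DeltaAx U → ∀ {e₀ pe₀ lam₀ : ℝ}, 0 < e₀ → 0 ≤ pe₀ → 0 < lam₀ → lam₀ ≤ 1 →
      17 * (P.d : ℝ) ^ 2 * (P.L : ℝ) ^ 2 * (e₀ * pe₀) < π →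
      2 * (17 * (P.d : ℝ) ^ 2 * (P.L : ℝ) ^ 2) * (e₀ * pe₀) ≤ lam₀ ^ (1 / 4 : ℝ) →
      (P.L : ℝ) * (e₀ * C * pe₀) ≤ lam₀ ^ (1 / 4 : ℝ) →
      ∀ {Λ : Finset (Balaban1983to89.Site P 0)} {Λ' Λ₀' : Finset (Balaban1983to89.Site P 1)} {Λ₁s Λ₄s Λ₆s : Finset (PBond P 0)},
      (∀ x : Balaban1983to89.Site P 0, blockOf x ∈ Λ' → x ∈ Λ) →
      (∀ p : Balaban1983to89.Plaq P 0, blockOf p.src ∈ Λ' → p ∈ starP Λ) →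
      (∀ q ∈ starP Λ₀', ∀ p : Balaban1983to89.Plaq P 0, blockOf p.src = q.src ∨ blockOf p.src = q.src.shift q.μ ∨
        blockOf p.src = q.src.shift q.ν ∨ blockOf p.src = (q.src.shift q.μ).shift q.ν → p ∈ starP Λ) →
      (∀ b ∈ Λ₁s, ∀ p : Balaban1983to89.Plaq P 0, blockOf p.src = blockOf b.src ∨ blockOf p.src = (blockOf b.src).shift b.dir →
        p ∈ starP Λ) →
      (∀ b ∈ Λ₁s, b ∈ Λ₄s → ∀ x : Balaban1983to89.Site P 0, (supDist b.src x : ℝ) ≤ R + 4 * P.L + 1 →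
        ∀ q : Balaban1983to89.Plaq P 1, q.src = blockOf x → q ∈ starP Λ₀') →
      (∀ b' ∈ starB Λ', ∀ s < P.L, (⟨LatticeFieldCalculus.runSite (embIter 1 b'.src) b'.dir s, b'.dir⟩ : PBond P 0) ∈ Λ₁s) →
      ∀ {ψ : Balaban1983to89.Site P 1 → ℂ} {φ : HiggsField P 0} {c' : ℝ}, 0 ≤ c' → c' ≤ 1 →
      SmallField315 pe₀ lam₀ Λ Λ' (covD 1 (cfg U) φ) ψ (qCov U φ) φ (fun p => ‖fieldStrength e₀ (plaqVar (cfg U) p)‖) →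
      ∀ (A0 : PBond P 0 → ℝ),
      BIJ88Sect3Translations.Aprime327 Λ₄s (P.L : ℝ) A0 (corr327 hd' R e₀ (cfg (qU U))) =
        (fun b => argB (toC (BIJ85BlockAveragesTorus.uPrime U b)) / e₀) →
      SmallBlock332 (2 * (17 * (P.d : ℝ) ^ 2 * (P.L : ℝ) ^ 2)) e₀ pe₀ lam₀ Λ' (plaqVar (cfg (qU U))) ψ
        (covD c' (fun c : PBond P 1 => ∏ s ∈ range P.L,
          u1bg Λ₁s Λ₄s Λ₆s (cfg (qsstarG (qU U))) e₀ (P.L : ℝ) A0 (corr327 hd' R e₀ (cfg (qU U)))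
            ⟨LatticeFieldCalculus.runSite (embIter 1 c.src) c.dir s, c.dir⟩) ψ) := by
  obtain ⟨M', δ', hM', hδ', H⟩ := cloc_decay d L hd
  have hd0 : 0 < d := by omega
  have hL0 : 0 < L := by omega
  set X : ℝ := M' * ((d : ℝ) * (2 * (1 + d / δ')) ^ d) * (4 * d) with hX_def
  have hX : 0 < X := by positivity
  refine ⟨6 * (d : ℝ) ^ 2 * (L : ℝ) ^ 2 + 2 * (X * (17 * (d : ℝ) ^ 2 * (L : ℝ) ^ 2)), by positivity, ?_⟩
  intro P hP hPL h1 hd' R U hU e₀ pe₀ lam₀ he hpe hlam hlam1 hπ hsm hsmC Λ Λ' Λ₀' Λ₁s Λ₄s Λ₆s hΛ₁ hΛ₂ hΛ₃ hΛ₁s hmarginB hline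
    ψ φ c' hc0 hc1 h A0 h327
  subst hP hPL
  have hC : ∀ b b' : PBond P 0, |Cloc P 0 R b b'| ≤ M' * Real.exp (-(δ' * distB P 0 b b')) := fun b b' => by
    convert H P rfl rfl 0 inferInstance h1 R b b' using 2
  have hsmall := plaqSmall_of_smallField315 he h
  have hεA : ∀ b ∈ Λ₁s, ∀ p : Balaban1983to89.Plaq P 0,
      blockOf p.src = blockOf b.src ∨ blockOf p.src = (blockOf b.src).shift b.dir → |argB (toC (plaqHol U p))| ≤ e₀ * pe₀ :=
    fun b hb p hp => hsmall p (hΛ₁s b hb p hp)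
  have hεF : ∀ q ∈ starP Λ₀', ∀ p : Balaban1983to89.Plaq P 0, blockOf p.src = q.src ∨ blockOf p.src = q.src.shift q.μ ∨
      blockOf p.src = q.src.shift q.ν ∨ blockOf p.src = (q.src.shift q.μ).shift q.ν → |argB (toC (plaqHol U p))| ≤ e₀ * pe₀ :=
    fun q hq p hp => hsmall p (hΛ₃ q hq p hp)
  -- (3.33) for `A^{(0)}` on `Λ₁*`: p27's `small333_gauge_of_plaquettes` BY NAME
  have h327' : BIJ88Sect3Translations.Aprime327 Λ₄s (P.L : ℝ) A0 ((Cloc P 0 R).mulVec (plaqDiv 1 ((torusEdgeCells P 0 hd').Qstar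
      (fun q => (fieldStrength e₀ (toC (plaqHol (qU U) q))).re)))) = fun b => argB (toC (BIJ85BlockAveragesTorus.uPrime U b)) / e₀ := by
    rw [← corr327_cfg_eq_mulVec]; exact h327
  have hA0 := BIJ88Small333GaugeField.small333_gauge_of_plaquettes h1 hd' hM'.le hδ' hC hU he hpe Λ₁s Λ₄s Λ₀' hεA hεF hπ hmarginB A0 h327'
  -- the size of the (3.27) correction on `Λ₁* ∩ Λ₄*`: p27's `abs_clocCorr_le_of_bound` BY NAME, fed by p31's `SmallF`
  have hF := smallF_of_plaquettes h1 hU he hpe Λ₀' hεF hπ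
  have hLpos : (0 : ℝ) < P.L := P.cast_L_pos
  have hK : ∀ b' ∈ starB Λ', ∀ s < P.L, (⟨LatticeFieldCalculus.runSite (embIter 1 b'.src) b'.dir s, b'.dir⟩ : PBond P 0) ∈ Λ₄s →
      (P.L : ℝ) ^ (-(2 : ℤ)) * |corr327 hd' R e₀ (cfg (qU U)) ⟨LatticeFieldCalculus.runSite (embIter 1 b'.src) b'.dir s, b'.dir⟩| ≤
        X * (17 * (P.d : ℝ) ^ 2 * (P.L : ℝ) ^ 2) * pe₀ := by
    intro b' hb' s hs hb₄
    set b : PBond P 0 := ⟨LatticeFieldCalculus.runSite (embIter 1 b'.src) b'.dir s, b'.dir⟩ with hb_def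
    have hcorr : |corr327 hd' R e₀ (cfg (qU U)) b| ≤ X * ((P.L : ℝ) ^ 2 * (17 * (P.d : ℝ) ^ 2 * (P.L : ℝ) ^ 2 * pe₀)) := by
      rw [corr327_eq_mulVec]
      exact abs_clocCorr_le_of_bound h1 hd' hM'.le hδ' hC (f326 e₀ (cfg (qU U))) b (by positivity)
        (fun q ⟨x, hx, hq⟩ => abs_f326_le_of_smallF hF (hmarginB b (hline b' hb' s hs) hb₄ x hx q hq.symm))
    have hL2 : (P.L : ℝ) ^ (-(2 : ℤ)) = ((P.L : ℝ) ^ 2)⁻¹ := by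
      rw [zpow_neg, zpow_ofNat]
    rw [hL2]
    calc ((P.L : ℝ) ^ 2)⁻¹ * |corr327 hd' R e₀ (cfg (qU U)) b|
        ≤ ((P.L : ℝ) ^ 2)⁻¹ * (X * ((P.L : ℝ) ^ 2 * (17 * (P.d : ℝ) ^ 2 * (P.L : ℝ) ^ 2 * pe₀))) :=
          mul_le_mul_of_nonneg_left hcorr (by positivity)
      _ = X * (17 * (P.d : ℝ) ^ 2 * (P.L : ℝ) ^ 2) * pe₀ := by
          rw [mul_left_comm X, inv_mul_cancel_left₀ (by positivity : ((P.L : ℝ) ^ 2) ≠ 0)]; ring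
  refine smallBlock332_u1bgBar_of_smallField315 h1 U he hpe hlam hlam1 hπ hsm hΛ₁ hΛ₂ hc0 hc1 h (P.L : ℝ) A0 _
    (a := (6 * (P.d : ℝ) ^ 2 * (P.L : ℝ) ^ 2 + X * (17 * (P.d : ℝ) ^ 2 * (P.L : ℝ) ^ 2)) * pe₀)
    (κ := X * (17 * (P.d : ℝ) ^ 2 * (P.L : ℝ) ^ 2) * pe₀) (by positivity) (by positivity) hline
    (fun b' hb' s hs _ => hA0 _ (hline b' hb' s hs)) hK ?_
  calc (P.L : ℝ) * (e₀ * ((6 * (P.d : ℝ) ^ 2 * (P.L : ℝ) ^ 2 + X * (17 * (P.d : ℝ) ^ 2 * (P.L : ℝ) ^ 2)) * pe₀) +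
        e₀ * (X * (17 * (P.d : ℝ) ^ 2 * (P.L : ℝ) ^ 2) * pe₀))
      = (P.L : ℝ) * (e₀ * (6 * (P.d : ℝ) ^ 2 * (P.L : ℝ) ^ 2 + 2 * (X * (17 * (P.d : ℝ) ^ 2 * (P.L : ℝ) ^ 2))) * pe₀) := by ring
    _ ≤ lam₀ ^ (1 / 4 : ℝ) := hsmC

end ByName

end

end Literature.MathematicalPhysics.QuantumFieldTheory.BalabanImbrieJaffe1984to88.BIJ88SmallBlockFields332Ubar
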